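import Literature.NumberTheory.Automorphic.ArchBigCellDerivatives
import Literature.NumberTheory.Automorphic.ArchWhittakerCharNondegenerate
import Literature.NumberTheory.Automorphic.ArchTestFunctionConvolution
import Literature.NumberTheory.Automorphic.ArchWhittakerUniquenessOfGKDistributions
import Literature.Analysis.Distribution.TranslationQuasiInvariantShear
import HarnessLib

/-!
# The Gelfand–Kazhdan symmetry of bi-`ψ_∞`-quasi-invariant distributions on the big Bruhat cell of
# `GL_n(K_∞)`

Topic `NumberTheory/Automorphic`; namespace `Literature.NumberTheory.Automorphic`. **The easy half of
(GK_∞)**: a distribution `T` on `GL_n(K_∞)` (`IsArchDistribution`) with `T(λ(u) f) = ψ_∞(u) T(f)` and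
`T(ρ(u) f) = ψ_∞(u)⁻¹ T(f)` for `u ∈ N` satisfies `T(f ∘ ι) = T(f)` for every test function `f` supported in the
big cell `Ω = N w⁰ A N` (`archBiWhittaker_gkInvolution_stable_of_tsupport_subset_bigCell`).

Proof (Shalika 1974, §2, the open cell; Gelfand–Kazhdan; in coordinates): transport `T` to the functional
`D = cellPull T` on `C_c^∞(𝔫 × (K_∞ˣ)ⁿ × 𝔫)` (`ArchBigCellDerivatives`), which is of finite order, additive and
homogeneous; the root elements of the last column (resp. first row) act by pure translations of the parameter
space (`ArchBigCellTransport`), so `D` is quasi-invariant along those directions; by induction over the columns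
(resp. rows) — the unipotent shears of the other columns only move already-integrated coordinates and are
invisible to the iterated line averages (`TranslationQuasiInvariantShear`) — `D` is quasi-invariant by pure
translations along *all* directions of `𝔫 × 𝔫`; hence (`TranslationQuasiInvariantFunctionalOn`,
`…ClosedForm`) `D h = D (W · A h)` with `A h` the iterated twisted line average over `𝔫 × 𝔫`, in any order of
the directions; finally `ι` is, in coordinates, the linear map `(X₁, a, X₂) ↦ (X₂♯, a, X₁♯)` permuting the
directions compatibly with the characters (`ψ_∞ ∘ ι = ψ_∞`) and fixing the torus, so `A (h ∘ ι̃) = A' h ∘ ι̃ = A' h`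
for the permuted list and `D (h ∘ ι̃) = D h` (`TranslationQuasiInvariantSubstitution`).

Everything is proved; no named fact is introduced.

## References

* J. A. Shalika, *The multiplicity one theorem for `GL_n`*, Ann. of Math. 100 (1974), §2 [Shalika1974].
* I. M. Gelfand, D. A. Kazhdan, *Representations of the group GL(n, K) where K is a local field* (1975),
  §§3–4 [GelfandKazhdan1975].
* L. Hörmander, *The Analysis of Linear Partial Differential Operators I* (1983/2003), Thm. 3.1.4'
  [HormanderALPDO1].
-/

noncomputable section

open MeasureTheory Measure NumberField NumberField.mixedEmbedding IsDedekindDomain Set Filter Matrix Real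
open Literature.Analysis.Distribution
open scoped MatrixGroups Topology Classical ContDiff Matrix.Norms.Operator

namespace Literature.NumberTheory.Automorphic

variable {n : ℕ} {K : Type} [Field K] [NumberField K]

-- as in `ArchGardingWhittaker`: the scoped `L∞`-operator normed ring structure on matrices is only
-- reducibly defeq to the Pi uniformity
set_option backward.isDefEq.respectTransparency false

local notation "R∞" => mixedSpace K
local notation "Mat" => Matrix (Fin n) (Fin n) (mixedSpace K)
local notation "G∞" => GL (Fin n) (mixedSpace K)
local notation "E∞" => CellParam n (mixedSpace K)

/-- `M_n(K_∞)` is finite-dimensional over `ℝ` (local instance, cf. `ArchBigCellDerivatives`). [folklore] -/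
private theorem finiteDimensional_matrix_mixedSpace_sym : FiniteDimensional ℝ (Matrix (Fin n) (Fin n) (mixedSpace K)) :=
  Module.Finite.matrix

attribute [local instance] finiteDimensional_matrix_mixedSpace_sym

/-- The parameter space is finite-dimensional over `ℝ`. [folklore] -/
private theorem finiteDimensional_cellParam_sym : FiniteDimensional ℝ (CellParam n (mixedSpace K)) := by
  unfold CellParam; infer_instance

attribute [local instance] finiteDimensional_cellParam_sym

/-- The parameter space is a free `ℝ`-module (a vector space; registered locally to cut instance search).
[folklore] -/
private theorem free_cellParam_sym : Module.Free ℝ (CellParam n (mixedSpace K)) := Module.Free.of_divisionRing ℝ _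

attribute [local instance] free_cellParam_sym

/-! ### 1. The coordinate directions of `𝔫 × 𝔫` -/

section Directions

variable {r : ℕ} (θ : Module.Basis (Fin r) ℝ (mixedSpace K))

omit [NumberField K] in
/-- The elementary strictly upper matrix `c E_{ij}` (`i < j`). [folklore] -/
theorem single_mem_strictUpper {i j : Fin n} (hij : i < j) (c : R∞) : Matrix.single i j c ∈ strictUpper n R∞ := by
  intro i' j' h
  by_cases h' : i = i' ∧ j = j'
  · obtain ⟨rfl, rfl⟩ := h'; exact absurd hij (not_lt.2 h)
  · simp only [Matrix.single, Matrix.of_apply, if_neg h']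

/-- **The real coordinate functional** `X ↦ θ*_k (X i j)` on `M_n(K_∞)`. [folklore] -/
def entryCoord (i j : Fin n) (k : Fin r) : Mat →L[ℝ] ℝ :=
  LinearMap.toContinuousLinearMap ((θ.coord k) ∘ₗ Matrix.entryLinearMap ℝ (mixedSpace K) i j)

/-- Evaluation of `entryCoord`. [folklore] -/
@[simp] theorem entryCoord_apply (i j : Fin n) (k : Fin r) (X : Mat) : entryCoord θ i j k X = θ.coord k (X i j) := rfl

/-- **The character exponent** of the direction `θ_k E_{ij}`: `-2π Tr_{K_∞/ℝ}(θ_k)` on the superdiagonal,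
`0` elsewhere. [folklore] -/
def dirLam (i j : Fin n) (k : Fin r) : ℝ := if (i : ℕ) + 1 = j then -(2 * π) * mixedTrace K (θ k) else 0

/-- **The left coordinate direction** `(θ_k E_{ij}, 0, 0)` with its dual coordinate and character exponent.
[folklore] -/
def leftDir (i j : Fin n) (hij : i < j) (k : Fin r) : Direction (CellParam n (mixedSpace K)) where
  v := leftRootVector (Matrix.single i j (θ k)) (single_mem_strictUpper hij _)
  φ := (entryCoord θ i j k).comp ((strictUpperReal n R∞).subtypeL.comp (ContinuousLinearMap.fst ℝ _ _))
  lam := dirLam θ i j k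
  hφv := by
    simp [leftRootVector, entryCoord, Matrix.single_apply_same]

/-- **The right coordinate direction** `(0, 0, θ_k E_{ij})`. [folklore] -/
def rightDir (i j : Fin n) (hij : i < j) (k : Fin r) : Direction (CellParam n (mixedSpace K)) where
  v := rightRootVector (Matrix.single i j (θ k)) (single_mem_strictUpper hij _)
  φ := (entryCoord θ i j k).comp ((strictUpperReal n R∞).subtypeL.comp
    ((ContinuousLinearMap.snd ℝ _ _).comp (ContinuousLinearMap.snd ℝ ↥(strictUpperReal n R∞) _)))
  lam := dirLam θ i j k
  hφv := by
    simp [rightRootVector, entryCoord, Matrix.single_apply_same]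

/-- The first (matrix) coordinate of a left direction. [folklore] -/
@[simp] theorem leftDir_v_fst (i j : Fin n) (hij : i < j) (k : Fin r) :
    (((leftDir θ i j hij k).v).1 : Mat) = Matrix.single i j (θ k) := rfl

/-- The torus coordinate of a left direction vanishes. [folklore] -/
@[simp] theorem leftDir_v_snd_fst (i j : Fin n) (hij : i < j) (k : Fin r) : ((leftDir θ i j hij k).v).2.1 = 0 := rfl

/-- The third coordinate of a left direction vanishes. [folklore] -/
@[simp] theorem leftDir_v_snd_snd (i j : Fin n) (hij : i < j) (k : Fin r) : (((leftDir θ i j hij k).v).2.2 : Mat) = 0 := rfl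

/-- The first coordinate of a right direction vanishes. [folklore] -/
@[simp] theorem rightDir_v_fst (i j : Fin n) (hij : i < j) (k : Fin r) : (((rightDir θ i j hij k).v).1 : Mat) = 0 := rfl

/-- The torus coordinate of a right direction vanishes. [folklore] -/
@[simp] theorem rightDir_v_snd_fst (i j : Fin n) (hij : i < j) (k : Fin r) : ((rightDir θ i j hij k).v).2.1 = 0 := rfl

/-- The third (matrix) coordinate of a right direction. [folklore] -/
@[simp] theorem rightDir_v_snd_snd (i j : Fin n) (hij : i < j) (k : Fin r) :
    (((rightDir θ i j hij k).v).2.2 : Mat) = Matrix.single i j (θ k) := rfl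

/-- The functional of a left direction reads a real coordinate of the `(i, j)` entry of `X₁`. [folklore] -/
@[simp] theorem leftDir_φ_apply (i j : Fin n) (hij : i < j) (k : Fin r) (e : E∞) :
    (leftDir θ i j hij k).φ e = θ.coord k ((e.1 : Mat) i j) := rfl

/-- The functional of a right direction reads a real coordinate of the `(i, j)` entry of `X₂`. [folklore] -/
@[simp] theorem rightDir_φ_apply (i j : Fin n) (hij : i < j) (k : Fin r) (e : E∞) :
    (rightDir θ i j hij k).φ e = θ.coord k ((e.2.2 : Mat) i j) := rfl

/-- The character exponents of left and right directions agree. [folklore] -/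
@[simp] theorem leftDir_lam (i j : Fin n) (hij : i < j) (k : Fin r) : (leftDir θ i j hij k).lam = dirLam θ i j k := rfl

/-- The character exponent of a right direction. [folklore] -/
@[simp] theorem rightDir_lam (i j : Fin n) (hij : i < j) (k : Fin r) : (rightDir θ i j hij k).lam = dirLam θ i j k := rfl

omit [NumberField K] in
/-- `θ*_k (single i j (θ k') i' j') = [i = i'] [j = j'] [k = k']`. [folklore] -/
theorem coord_single_apply (i j i' j' : Fin n) (k k' : Fin r) :
    θ.coord k (Matrix.single i' j' (θ k') i j) = if i' = i ∧ j' = j ∧ k' = k then 1 else 0 := by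
  by_cases h : i' = i ∧ j' = j
  · obtain ⟨rfl, rfl⟩ := h
    rw [Matrix.single_apply_same, Module.Basis.coord_apply, Module.Basis.repr_self, Finsupp.single_apply]
    by_cases hk : k' = k
    · subst hk; simp
    · simp [hk]
  · rw [show Matrix.single i' j' (θ k') i j = 0 by simp only [Matrix.single, Matrix.of_apply, if_neg h], map_zero]
    rw [if_neg (fun h' => h ⟨h'.1, h'.2.1⟩)]

/-- **Biorthogonality, left–left.** [folklore] -/
theorem leftDir_φ_leftDir_v (i j : Fin n) (hij : i < j) (k : Fin r) (i' j' : Fin n) (hij' : i' < j') (k' : Fin r) :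
    (leftDir θ i j hij k).φ (leftDir θ i' j' hij' k').v = if i' = i ∧ j' = j ∧ k' = k then 1 else 0 := by
  rw [leftDir_φ_apply, leftDir_v_fst, coord_single_apply]

/-- **Biorthogonality, right–right.** [folklore] -/
theorem rightDir_φ_rightDir_v (i j : Fin n) (hij : i < j) (k : Fin r) (i' j' : Fin n) (hij' : i' < j') (k' : Fin r) :
    (rightDir θ i j hij k).φ (rightDir θ i' j' hij' k').v = if i' = i ∧ j' = j ∧ k' = k then 1 else 0 := by
  rw [rightDir_φ_apply, rightDir_v_snd_snd, coord_single_apply]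

/-- **Biorthogonality, left–right.** [folklore] -/
@[simp] theorem leftDir_φ_rightDir_v (i j : Fin n) (hij : i < j) (k : Fin r) (i' j' : Fin n) (hij' : i' < j') (k' : Fin r) :
    (leftDir θ i j hij k).φ (rightDir θ i' j' hij' k').v = 0 := by
  rw [leftDir_φ_apply, rightDir_v_fst, Matrix.zero_apply, map_zero]

/-- **Biorthogonality, right–left.** [folklore] -/
@[simp] theorem rightDir_φ_leftDir_v (i j : Fin n) (hij : i < j) (k : Fin r) (i' j' : Fin n) (hij' : i' < j') (k' : Fin r) :
    (rightDir θ i j hij k).φ (leftDir θ i' j' hij' k').v = 0 := by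
  rw [rightDir_φ_apply, leftDir_v_snd_snd, Matrix.zero_apply, map_zero]

/-- **The index type of the coordinate directions of one unipotent factor**: `(i < j, k)`. [folklore] -/
abbrev DirIdx (n r : ℕ) : Type := {p : Fin n × Fin n // p.1 < p.2} × Fin r

/-- The left direction of an index. [folklore] -/
def dirL (ι : DirIdx n r) : Direction (CellParam n (mixedSpace K)) := leftDir θ ι.1.1.1 ι.1.1.2 ι.1.2 ι.2

/-- The right direction of an index. [folklore] -/
def dirR (ι : DirIdx n r) : Direction (CellParam n (mixedSpace K)) := rightDir θ ι.1.1.1 ι.1.1.2 ι.1.2 ι.2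

/-- **All coordinate directions**: left ones tagged `inl`, right ones `inr`. [folklore] -/
def dirLR : DirIdx n r ⊕ DirIdx n r → Direction (CellParam n (mixedSpace K))
  | Sum.inl ι => dirL θ ι
  | Sum.inr ι => dirR θ ι

/-- **Biorthogonality of distinct coordinate directions.** [folklore] -/
theorem dirLR_biorthogonal {a b : DirIdx n r ⊕ DirIdx n r} (hab : a ≠ b) :
    (dirLR θ a).φ (dirLR θ b).v = 0 ∧ (dirLR θ b).φ (dirLR θ a).v = 0 := by
  rcases a with ⟨⟨⟨i, j⟩, hij⟩, k⟩ | ⟨⟨⟨i, j⟩, hij⟩, k⟩ <;> rcases b with ⟨⟨⟨i', j'⟩, hij'⟩, k'⟩ | ⟨⟨⟨i', j'⟩, hij'⟩, k'⟩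
  · simp only [dirLR, dirL, leftDir_φ_leftDir_v]
    constructor
    · rw [if_neg]; rintro ⟨rfl, rfl, rfl⟩; exact hab rfl
    · rw [if_neg]; rintro ⟨rfl, rfl, rfl⟩; exact hab rfl
  · simp [dirLR, dirL, dirR]
  · simp [dirLR, dirL, dirR]
  · simp only [dirLR, dirR, rightDir_φ_rightDir_v]
    constructor
    · rw [if_neg]; rintro ⟨rfl, rfl, rfl⟩; exact hab rfl
    · rw [if_neg]; rintro ⟨rfl, rfl, rfl⟩; exact hab rfl

/-- **Any duplicate-free list of coordinate directions is biorthogonal.** [folklore] -/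
theorem biorthogonal_map_dirLR {l : List (DirIdx n r ⊕ DirIdx n r)} (hl : l.Nodup) : Biorthogonal (l.map (dirLR θ)) := by
  unfold Biorthogonal
  rw [List.pairwise_map]
  exact hl.pairwise_of_forall_ne fun a _ b _ hab => dirLR_biorthogonal θ hab

end Directions

/-! ### 2. The characters of the root elements -/

section Characters

variable {r : ℕ} (θ : Module.Basis (Fin r) ℝ (mixedSpace K))

/-- **The superdiagonal sum of a root element** `1 + t E_{ij}(c)`: `t c` if `j = i + 1`, else `0`. [folklore] -/
theorem superdiagSum_rootElement_single (i j : Fin n) (hij : i < j) (c : R∞) (t : ℝ) :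
    superdiagSum (rootElement (Matrix.single i j c) (single_mem_strictUpper hij c) t) =
      if (i : ℕ) + 1 = j then t • c else 0 := by
  rw [superdiagSum_def]
  simp only [coe_rootElement, Matrix.add_apply, Matrix.smul_apply]
  have hsummand : ∀ a b : Fin n, (if (a : ℕ) + 1 = b then (1 : Mat) a b + t • Matrix.single i j c a b else 0) =
      if a = i ∧ b = j then (if (i : ℕ) + 1 = j then t • c else 0) else 0 := by
    intro a b
    by_cases hab : (a : ℕ) + 1 = b
    · rw [if_pos hab, Matrix.one_apply, if_neg (fun h : a = b => by subst h; omega), zero_add]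
      by_cases h2 : a = i ∧ b = j
      · obtain ⟨rfl, rfl⟩ := h2
        rw [if_pos ⟨rfl, rfl⟩, if_pos hab, Matrix.single_apply_same]
      · rw [if_neg h2, show Matrix.single i j c a b = 0 by
          simp only [Matrix.single, Matrix.of_apply, if_neg (fun h' : i = a ∧ j = b => h2 ⟨h'.1.symm, h'.2.symm⟩)],
          smul_zero]
    · rw [if_neg hab]
      by_cases h2 : a = i ∧ b = j
      · obtain ⟨rfl, rfl⟩ := h2
        rw [if_pos ⟨rfl, rfl⟩, if_neg hab]
      · rw [if_neg h2]
  simp only [hsummand]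
  rw [Finset.sum_eq_single i (fun a _ ha => by simp [ha]) (fun h => absurd (Finset.mem_univ i) h)]
  rw [Finset.sum_eq_single j (fun b _ hb => by simp [hb]) (fun h => absurd (Finset.mem_univ j) h)]
  simp

/-- **The character of a root element**: `ψ_∞(1 + t θ_k E_{ij}) = exp(i λ_{ijk} t)`, `λ = dirLam θ i j k`.
[folklore] -/
theorem archWhittakerChar_rootElement (i j : Fin n) (hij : i < j) (k : Fin r) (t : ℝ) :
    archWhittakerChar n K (rootElement (Matrix.single i j (θ k)) (single_mem_strictUpper hij _) t) =
      Complex.exp (((dirLam θ i j k * t : ℝ) : ℂ) * Complex.I) := by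
  rw [archWhittakerChar_eq_cexp, superdiagSum_rootElement_single i j hij]
  unfold dirLam
  by_cases h : (i : ℕ) + 1 = j
  · rw [if_pos h, if_pos h, map_smul, smul_eq_mul]
    congr 1
    push_cast
    ring
  · rw [if_neg h, if_neg h, map_zero, mul_zero, zero_mul]

end Characters

/-! ### 3. The transported functional and the admissible functions -/

section Functional

variable {r : ℕ} (θ : Module.Basis (Fin r) ℝ (mixedSpace K))

/-- **`cellSource` is saturated along every coordinate direction** (they have zero torus component). [folklore] -/
theorem isSaturated_cellSource_dirLR (a : DirIdx n r ⊕ DirIdx n r) :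
    IsSaturated (dirLR θ a).v (dirLR θ a).φ (cellSource n R∞) := by
  intro x hx s
  have htorus : ((dirLR θ a).v).2.1 = 0 := by
    rcases a with ι | ι
    · rfl
    · rfl
  show ∀ i, IsUnit ((s • (dirLR θ a).v + (x - ((dirLR θ a).φ x) • (dirLR θ a).v)).2.1 i)
  intro i
  simp only [Prod.snd_add, Prod.fst_add, Prod.smul_snd, Prod.smul_fst, Prod.snd_sub, Prod.fst_sub, htorus, smul_zero,
    zero_add, sub_zero]
  exact hx i

variable (T : ↥(archTestFunctions n K) →ₗ[ℂ] ℂ)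

/-- Translates of admissible functions along coordinate directions are admissible. [folklore] -/
theorem admissible_translate (a : DirIdx n r ⊕ DirIdx n r) {h : E∞ → ℂ} (hh : IsTestFn h)
    (hW : tsupport h ⊆ cellSource n R∞) (t : ℝ) :
    IsTestFn (Analysis.Distribution.translate (t • (dirLR θ a).v) h) ∧
      tsupport (Analysis.Distribution.translate (t • (dirLR θ a).v) h) ⊆ cellSource n R∞ :=
  ⟨hh.translate _, tsupport_translate_subset_of_saturated (isSaturated_cellSource_dirLR θ a) hW t⟩

/-! ### 4. Quasi-invariance along the last column (left) and the first row (right) -/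

omit [NumberField K] in
/-- Rows of strictly upper matrices: the row of the last index vanishes, so `E_{i,last} X = 0`. [folklore] -/
theorem single_last_mul_eq_zero {i j : Fin n} (hj : ∀ m : Fin n, m ≤ j) (c : R∞) {X : Mat} (hX : X ∈ strictUpper n R∞) :
    Matrix.single i j c * X = 0 := by
  refine Matrix.ext fun a b => ?_
  rw [Matrix.zero_apply]
  by_cases ha : a = i
  · subst ha; rw [Matrix.single_mul_apply_same, hX j b (hj b), mul_zero]
  · exact Matrix.single_mul_apply_of_ne (c := c) i j a b ha X

omit [NumberField K] in
/-- Columns of strictly upper matrices: the column of the first index vanishes, so `X E_{first,j} = 0`. [folklore] -/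
theorem mul_single_first_eq_zero {i j : Fin n} (hi : ∀ m : Fin n, i ≤ m) (c : R∞) {X : Mat} (hX : X ∈ strictUpper n R∞) :
    X * Matrix.single i j c = 0 := by
  refine Matrix.ext fun a b => ?_
  rw [Matrix.zero_apply]
  by_cases hb : b = j
  · subst hb; rw [Matrix.mul_single_apply_same, hX a i (hi a), zero_mul]
  · exact Matrix.mul_single_apply_of_ne (c := c) i j a b hb X

/-- **Left quasi-invariance of `T` transports to translation quasi-invariance of `cellPull T` along the
last-column directions.** [folklore] -/
theorem cellPull_translate_leftDir_last
    (hL : ∀ (u : ↥(upperUnitriangular (Fin n) (mixedSpace K))) (f : ↥(archTestFunctions n K)),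
      T (archTestFunctions.leftTranslate (u : G∞) f) = archWhittakerChar n K u * T f)
    (i j : Fin n) (hij : i < j) (hj : ∀ m : Fin n, m ≤ j) (k : Fin r) {h : E∞ → ℂ} (hh : IsTestFn h)
    (hW : tsupport h ⊆ cellSource n R∞) (t : ℝ) :
    cellPull T (Analysis.Distribution.translate (t • (leftDir θ i j hij k).v) h) =
      Complex.exp (((dirLam θ i j k * t : ℝ) : ℂ) * Complex.I) * cellPull T h := by
  have hadm := admissible_translate θ (Sum.inl ⟨⟨(i, j), hij⟩, k⟩) hh hW t
  have hadm' : IsTestFn (Analysis.Distribution.translate (t • (leftDir θ i j hij k).v) h) ∧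
      tsupport (Analysis.Distribution.translate (t • (leftDir θ i j hij k).v) h) ⊆ cellSource n R∞ := hadm
  rw [cellPull_eq T hadm'.1 hadm'.2, cellPull_eq T hh hW, ← archWhittakerChar_rootElement θ i j hij k t,
    ← hL (rootElement (Matrix.single i j (θ k)) (single_mem_strictUpper hij _) t) (cellPushFn h ⟨hh, hW⟩)]
  congr 1
  apply Subtype.ext
  funext x
  rw [archTestFunctions.leftTranslate_apply, coe_cellPushFn, coe_cellPushFn, ← Subgroup.coe_inv,
    cellPush_rootElement_inv_mul (single_mem_strictUpper hij _)
      (fun X hX => single_last_mul_eq_zero hj (θ k) hX) t h x]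
  rfl

/-- **Right quasi-invariance of `T` transports to translation quasi-invariance of `cellPull T` along the
first-row directions** (with the same character exponent: `ρ(u_{-t})` realises the translation by `t w` and
`ψ(u_{-t})⁻¹ = e^{iλt}`). [folklore] -/
theorem cellPull_translate_rightDir_first
    (hR : ∀ (u : ↥(upperUnitriangular (Fin n) (mixedSpace K))) (f : ↥(archTestFunctions n K)),
      T (archTestFunctions.rightTranslate (u : G∞) f) = (archWhittakerChar n K u)⁻¹ * T f)
    (i j : Fin n) (hij : i < j) (hi : ∀ m : Fin n, i ≤ m) (k : Fin r) {h : E∞ → ℂ} (hh : IsTestFn h)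
    (hW : tsupport h ⊆ cellSource n R∞) (t : ℝ) :
    cellPull T (Analysis.Distribution.translate (t • (rightDir θ i j hij k).v) h) =
      Complex.exp (((dirLam θ i j k * t : ℝ) : ℂ) * Complex.I) * cellPull T h := by
  have hadm := admissible_translate θ (Sum.inr ⟨⟨(i, j), hij⟩, k⟩) hh hW t
  have hadm' : IsTestFn (Analysis.Distribution.translate (t • (rightDir θ i j hij k).v) h) ∧
      tsupport (Analysis.Distribution.translate (t • (rightDir θ i j hij k).v) h) ⊆ cellSource n R∞ := hadm
  have hchar : Complex.exp (((dirLam θ i j k * t : ℝ) : ℂ) * Complex.I) =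
      (archWhittakerChar n K (rootElement (Matrix.single i j (θ k)) (single_mem_strictUpper hij _) (-t)))⁻¹ := by
    rw [archWhittakerChar_rootElement θ i j hij k (-t), ← Complex.exp_neg]
    congr 1
    push_cast
    ring
  rw [cellPull_eq T hadm'.1 hadm'.2, cellPull_eq T hh hW, hchar,
    ← hR (rootElement (Matrix.single i j (θ k)) (single_mem_strictUpper hij _) (-t)) (cellPushFn h ⟨hh, hW⟩)]
  congr 1
  apply Subtype.ext
  funext x
  rw [archTestFunctions.rightTranslate_apply, coe_cellPushFn, coe_cellPushFn,
    cellPush_mul_rootElement (single_mem_strictUpper hij _) (fun X hX => mul_single_first_eq_zero hi (θ k) hX) (-t) h x]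
  congr 1
  funext e
  rw [Analysis.Distribution.translate_apply, sub_eq_add_neg]
  congr 2
  exact (neg_smul t ((rightDir θ i j hij k).v)).symm

end Functional

/-! ### 5. The shear step: quasi-invariance under a sheared translation is quasi-invariance under the
translation, once the sheared block is already integrated -/

section ShearStep

variable {Y : Type*} [NormedAddCommGroup Y] [NormedSpace ℝ Y]

/-- `A_{B ++ M} f = A_M (A_B f)`. [folklore] -/
theorem lineAvgList_append_left (M : List (Direction Y)) (f : Y → ℂ) :
    ∀ B : List (Direction Y), lineAvgList (B ++ M) f = lineAvgList M (lineAvgList B f)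
  | [] => rfl
  | b :: B => by
    rw [List.cons_append, lineAvgList, lineAvgList, lineAvgList_append_left M (lineAvg b f) B]

/-- **The abstract shear step.** Let `D` satisfy the structure theorem `D G = D (P_{B ++ M} G)` on the test
functions supported in `W` (the outcome of `apply_eq_apply_lineProjList_on`), with `B ++ M` biorthogonal and
`λ = 0` on the block `B`. Suppose that a sheared translate of `f`, `x ↦ f (x - t v - U x)` with `U` valued in
the span of the `B`-directions and constant along the `B`-lines, is multiplied by `c` under `D`. Then so is the
plain translate: `D (τ_{t v} f) = c · D f`. [folklore] -/
theorem apply_translate_eq_of_shear {D : (Y → ℂ) → ℂ} {W : Set Y} {B M : List (Direction Y)}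
    (hBM : Biorthogonal (B ++ M)) (hlam : ∀ b ∈ B, b.lam = 0)
    (hP : ∀ G : Y → ℂ, IsTestFn G → tsupport G ⊆ W → D G = D (lineProjList (B ++ M) G))
    {U : Y → Y} (hspan : ∀ x, U x ∈ Submodule.span ℝ (Set.range fun b : {b // b ∈ B} => b.1.v))
    (hinv : ∀ b ∈ B, IsLineInvariantV b U)
    {f : Y → ℂ} {v : Y} {t : ℝ} {c : ℂ}
    (hsheared : IsTestFn (fun x => f (x - t • v - U x)) ∧ tsupport (fun x => f (x - t • v - U x)) ⊆ W)
    (htranslate : IsTestFn (Analysis.Distribution.translate (t • v) f) ∧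
      tsupport (Analysis.Distribution.translate (t • v) f) ⊆ W)
    (hS : D (fun x => f (x - t • v - U x)) = c * D f) :
    D (Analysis.Distribution.translate (t • v) f) = c * D f := by
  have hB : Biorthogonal B := (List.pairwise_append.1 hBM).1
  set g : Y → ℂ := Analysis.Distribution.translate (t • v) f with hg
  have hfg : (fun x => f (x - t • v - U x)) = fun x => g (x - U x) := by
    funext x
    simp only [hg, Analysis.Distribution.translate_apply]
    congr 1
    abel
  rw [← hS, hfg]
  refine (apply_eq_of_lineAvgList_eq (D := D) hBM (hP _ ?_ ?_) (hP g htranslate.1 htranslate.2) ?_).symm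
  · rw [← hfg]; exact hsheared.1
  · rw [← hfg]; exact hsheared.2
  · rw [lineAvgList_append_left, lineAvgList_append_left, lineAvgList_comp_sub_shear B hB hlam hspan hinv g]

end ShearStep

/-! ### 6. The concrete shears of the left action -/

section LeftShear

variable {r : ℕ} (θ : Module.Basis (Fin r) ℝ (mixedSpace K))

omit [NumberField K] in
/-- Upper unitriangular matrices are upper triangular (as matrices). [folklore] -/
theorem upper_of_mem_upperUnitriangular (u : ↥(upperUnitriangular (Fin n) R∞)) :
    ∀ i j : Fin n, j < i → ((u : G∞) : Mat) i j = 0 := fun _ _ hij =>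
  ((mem_upperUnitriangular_iff _).1 u.2).1 hij

/-- **The linear part of `leftParamMap u`**: `(X₁, a, X₂) ↦ (u X₁, a, X₂)`. [folklore] -/
def leftParamLin (u : ↥(upperUnitriangular (Fin n) R∞)) : E∞ →L[ℝ] E∞ :=
  LinearMap.toContinuousLinearMap
    { toFun := fun e => (⟨((u : G∞) : Mat) * (e.1 : Mat),
        upper_mul_strictUpper e.1.2 (upper_of_mem_upperUnitriangular u)⟩, e.2.1, e.2.2)
      map_add' := fun e e' => by
        refine Prod.ext (Subtype.ext ?_) rfl
        simp only [Prod.fst_add, Submodule.coe_add, Matrix.mul_add]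
      map_smul' := fun c e => by
        refine Prod.ext (Subtype.ext ?_) rfl
        simp only [Prod.smul_fst, Submodule.coe_smul, RingHom.id_apply, Matrix.mul_smul] }

/-- `leftParamMap u` is the affine map `leftParamLin u + (u - 1, 0, 0)`. [folklore] -/
theorem leftParamMap_eq_lin_add (u : ↥(upperUnitriangular (Fin n) R∞)) (e : E∞) :
    leftParamMap u e = leftParamLin u e + (⟨((u : G∞) : Mat) - 1, sub_one_mem_strictUpper u.2⟩, 0, 0) := by
  refine Prod.ext (Subtype.ext ?_) (Prod.ext ?_ ?_)
  · simp only [leftParamMap_fst, leftParamLin, LinearMap.coe_toContinuousLinearMap', LinearMap.coe_mk,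
      AddHom.coe_mk, Prod.fst_add, Submodule.coe_add]
    rw [Matrix.mul_add, Matrix.mul_one]
    abel
  · simp [leftParamLin]
  · simp [leftParamLin]

/-- **`leftParamMap u` is smooth.** [folklore] -/
theorem contDiff_leftParamMap (u : ↥(upperUnitriangular (Fin n) R∞)) : ContDiff ℝ ∞ (leftParamMap u) := by
  have h : leftParamMap u = fun e => leftParamLin u e + (⟨((u : G∞) : Mat) - 1, sub_one_mem_strictUpper u.2⟩, 0, 0) :=
    funext (leftParamMap_eq_lin_add u)
  rw [h]
  exact (leftParamLin u).contDiff.add contDiff_const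

/-- **`leftParamMap u` as a homeomorphism** (inverse `leftParamMap u⁻¹`). [folklore] -/
def leftParamHomeo (u : ↥(upperUnitriangular (Fin n) R∞)) : E∞ ≃ₜ E∞ where
  toFun := leftParamMap u
  invFun := leftParamMap u⁻¹
  left_inv e := by rw [← leftParamMap_mul, inv_mul_cancel, leftParamMap_one]
  right_inv e := by rw [← leftParamMap_mul, mul_inv_cancel, leftParamMap_one]
  continuous_toFun := (contDiff_leftParamMap u).continuous
  continuous_invFun := (contDiff_leftParamMap u⁻¹).continuous

/-- **Admissibility is preserved by `leftParamMap u`.** [folklore] -/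
theorem admissible_comp_leftParamMap (u : ↥(upperUnitriangular (Fin n) R∞)) {h : E∞ → ℂ} (hh : IsTestFn h)
    (hW : tsupport h ⊆ cellSource n R∞) :
    IsTestFn (h ∘ leftParamMap u) ∧ tsupport (h ∘ leftParamMap u) ⊆ cellSource n R∞ := by
  refine ⟨⟨hh.contDiff.comp (contDiff_leftParamMap u), hh.hasCompactSupport.comp_homeomorph (leftParamHomeo u)⟩, ?_⟩
  have hsub : tsupport (h ∘ leftParamMap u) ⊆ leftParamMap u ⁻¹' tsupport h := by
    refine closure_minimal ?_ ((isClosed_tsupport h).preimage (contDiff_leftParamMap u).continuous)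
    rw [Function.support_comp_eq_preimage]
    exact Set.preimage_mono subset_closure
  intro x hx
  have h1 : leftParamMap u x ∈ cellSource n R∞ := hW (hsub hx)
  exact h1

/-- **The left shear vector field** of `E`: `U_s(x) = (s E X₁, 0, 0)`. [folklore] -/
def leftShearVec (E : Mat) (hE : E ∈ strictUpper n R∞) (s : ℝ) (x : E∞) : E∞ :=
  (⟨s • (E * (x.1 : Mat)), (strictUpperReal n R∞).smul_mem s (strictUpper_mul hE x.1.2)⟩, 0, 0)

/-- The first component of the shear field. [folklore] -/
@[simp] theorem leftShearVec_fst (E : Mat) (hE : E ∈ strictUpper n R∞) (s : ℝ) (x : E∞) :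
    ((leftShearVec E hE s x).1 : Mat) = s • (E * (x.1 : Mat)) := rfl

/-- **The left action of a root element in coordinates is a sheared translation**:
`leftParamMap (1 - tE) x = x - t (E, 0, 0) - U_t(x)`. [folklore] -/
theorem leftParamMap_rootElement_neg (E : Mat) (hE : E ∈ strictUpper n R∞) (t : ℝ) (x : E∞) :
    leftParamMap (rootElement E hE (-t)) x = x - t • leftRootVector E hE - leftShearVec E hE t x := by
  obtain ⟨⟨X₁, hX₁⟩, a, X₂⟩ := x
  refine Prod.ext (Subtype.ext ?_) (Prod.ext ?_ ?_)
  · simp only [leftParamMap_fst, coe_rootElement, leftRootVector, leftShearVec, Prod.fst_sub, Prod.smul_fst,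
      Submodule.coe_sub, Submodule.coe_smul]
    rw [add_mul, Matrix.one_mul, Matrix.mul_add, Matrix.mul_one, smul_mul_assoc, neg_smul, neg_smul]
    abel
  · simp [leftRootVector, leftShearVec]
  · simp [leftRootVector, leftShearVec]

omit [NumberField K] in
/-- **Row-`i` matrices beyond column `col` expand in the elementary matrices `single i b (θ k')`.**
[folklore] -/
theorem eq_sum_single_of_row (i col : Fin n) {Y : Mat} (hY : ∀ a b : Fin n, ¬(a = i ∧ col < b) → Y a b = 0) :
    Y = ∑ b : {b : Fin n // col < b}, ∑ k' : Fin r, θ.coord k' (Y i b.1) • Matrix.single i b.1 (θ k') := by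
  refine Matrix.ext fun a b' => ?_
  simp only [Matrix.sum_apply, Matrix.smul_apply]
  by_cases hab : a = i ∧ col < b'
  · obtain ⟨rfl, hb'⟩ := hab
    rw [Finset.sum_eq_single (⟨b', hb'⟩ : {b : Fin n // col < b}) (fun b _ hb => ?_) (fun h => absurd (Finset.mem_univ _) h)]
    · simp only [Matrix.single_apply_same]
      conv_lhs => rw [← θ.sum_repr (Y a b')]
      refine Finset.sum_congr rfl fun k' _ => ?_
      rw [Module.Basis.coord_apply]
    · refine Finset.sum_eq_zero fun k' _ => ?_
      rw [show Matrix.single a b.1 (θ k') a b' = 0 by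
        simp only [Matrix.single, Matrix.of_apply, true_and]
        rw [if_neg (fun h : b.1 = b' => hb (Subtype.ext h))], smul_zero]
  · rw [hY a b' hab]
    symm
    refine Finset.sum_eq_zero fun b _ => Finset.sum_eq_zero fun k' _ => ?_
    rw [show Matrix.single i b.1 (θ k') a b' = 0 by
      simp only [Matrix.single, Matrix.of_apply]
      rw [if_neg]
      rintro ⟨rfl, rfl⟩
      exact hab ⟨rfl, b.2⟩, smul_zero]

/-- **The shear field lies in the span of the block directions** `(leftDir i b k')`, `col < b`. [folklore] -/
theorem leftShearVec_mem_span (i col : Fin n) (hic : i < col) (k : Fin r) (t : ℝ) (x : E∞)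
    (S : Submodule ℝ E∞) (hS : ∀ (b : Fin n) (hb : col < b) (k' : Fin r), (leftDir θ i b (lt_trans hic hb) k').v ∈ S) :
    leftShearVec (Matrix.single i col (θ k)) (single_mem_strictUpper hic _) t x ∈ S := by
  -- the first component is supported in row `i`, columns `> col`
  set Y : Mat := t • (Matrix.single i col (θ k) * (x.1 : Mat)) with hYdef
  have hY : ∀ a b : Fin n, ¬(a = i ∧ col < b) → Y a b = 0 := by
    intro a b hab
    simp only [hYdef, Matrix.smul_apply]
    by_cases ha : a = i
    · subst ha
      rw [Matrix.single_mul_apply_same, x.1.2 col b (not_lt.1 fun hb => hab ⟨rfl, hb⟩), mul_zero, smul_zero]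
    · rw [Matrix.single_mul_apply_of_ne (c := θ k) i col a b ha, smul_zero]
  -- the embedding of the first factor
  set ι₁ : ↥(strictUpperReal n R∞) →ₗ[ℝ] E∞ := LinearMap.inl ℝ _ _ with hι₁
  have hvec : leftShearVec (Matrix.single i col (θ k)) (single_mem_strictUpper hic _) t x =
      ∑ b : {b : Fin n // col < b}, ∑ k' : Fin r, θ.coord k' (Y i b.1) • (leftDir θ i b.1 (lt_trans hic b.2) k').v := by
    have hx1 : (x.1 : Mat) ∈ strictUpper n R∞ := x.1.2
    have h1 : leftShearVec (Matrix.single i col (θ k)) (single_mem_strictUpper hic _) t x =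
        ι₁ ⟨Y, (strictUpperReal n R∞).smul_mem t (strictUpper_mul (single_mem_strictUpper hic _) hx1)⟩ := rfl
    have h2 : ∀ (b : {b : Fin n // col < b}) (k' : Fin r), (leftDir θ i b.1 (lt_trans hic b.2) k').v =
        ι₁ ⟨Matrix.single i b.1 (θ k'), single_mem_strictUpper (lt_trans hic b.2) _⟩ := fun b k' => rfl
    simp_rw [h1, h2, ← map_smul, ← _root_.map_sum]
    congr 1
    apply Subtype.ext
    simp only [Submodule.coe_sum, Submodule.coe_smul]
    exact eq_sum_single_of_row θ i col hY
  rw [hvec]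
  exact Submodule.sum_mem _ fun b _ => Submodule.sum_mem _ fun k' _ => Submodule.smul_mem _ _ (hS b.1 b.2 k')

/-- **The shear field is constant along the block lines** (it only depends on row `col` of `X₁`). [folklore] -/
theorem isLineInvariantV_leftShearVec (i col : Fin n) (hic : i < col) (k : Fin r) (t : ℝ) (b : Fin n) (hib : i < b)
    (k' : Fin r) :
    IsLineInvariantV (leftDir θ i b hib k') (leftShearVec (Matrix.single i col (θ k)) (single_mem_strictUpper hic _) t) := by
  intro x s
  refine Prod.ext (Subtype.ext ?_) rfl
  simp only [leftShearVec_fst, Prod.fst_add, Prod.smul_fst, Prod.fst_sub, Submodule.coe_add, Submodule.coe_smul,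
    Submodule.coe_sub, leftDir_v_fst]
  rw [Matrix.mul_add, Matrix.mul_sub, Matrix.mul_smul, Matrix.mul_smul,
    Matrix.single_mul_single_of_ne (c := θ k) i col i (ne_of_gt hic) (θ k'), smul_zero, smul_zero, zero_add, sub_zero]

/-- Block directions `(i, b)` with `col < b`, `i < col` are untwisted: `λ = 0`. [folklore] -/
theorem dirLam_eq_zero_of_lt_lt (i col b : Fin n) (hic : i < col) (hb : col < b) (k' : Fin r) : dirLam θ i b k' = 0 := by
  unfold dirLam
  rw [if_neg]
  have h1 : (i : ℕ) < col := hic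
  have h2 : (col : ℕ) < b := hb
  omega

end LeftShear

/-! ### 7. The left induction over the columns -/

section LeftStep

variable {r : ℕ} (θ : Module.Basis (Fin r) ℝ (mixedSpace K)) (T : ↥(archTestFunctions n K) →ₗ[ℂ] ℂ)

/-- **Quasi-invariance of `cellPull T` by pure translations along the direction `d`** (the hypothesis `hq` of
`apply_eq_apply_lineProjList_on`). [folklore] -/
def QI (d : Direction (CellParam n (mixedSpace K))) : Prop :=
  ∀ (h : E∞ → ℂ), IsTestFn h → tsupport h ⊆ cellSource n R∞ → ∀ t : ℝ,
    cellPull T (Analysis.Distribution.translate (t • d.v) h) = Complex.exp (((d.lam * t : ℝ) : ℂ) * Complex.I) * cellPull T h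

/-- **The structure theorem for `cellPull T`** along any duplicate-free list of coordinate directions along which
it is quasi-invariant. [folklore] -/
theorem cellPull_eq_cellPull_lineProjList (hT : IsArchDistribution n K T) {l : List (DirIdx n r ⊕ DirIdx n r)}
    (hq : ∀ a ∈ l, QI T (dirLR θ a)) {G : E∞ → ℂ} (hG : IsTestFn G) (hGW : tsupport G ⊆ cellSource n R∞) :
    cellPull T G = cellPull T (lineProjList (l.map (dirLR θ)) G) := by
  refine apply_eq_apply_lineProjList_on (W := cellSource n R∞) (D := cellPull T) (cellPull_add T) (cellPull_smul T)
    (isFiniteOrderOn_cellPull (Module.finBasis ℝ (CellParam n (mixedSpace K))) T hT) (l.map (dirLR θ)) ?_ ?_ hG hGW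
  · intro d hd
    obtain ⟨a, _, rfl⟩ := List.mem_map.1 hd
    exact isSaturated_cellSource_dirLR θ a
  · intro d hd f hf hfW t
    obtain ⟨a, ha, rfl⟩ := List.mem_map.1 hd
    exact hq a ha f hf hfW t

/-- **The left step**: quasi-invariance along all left directions of the columns `> col` implies quasi-invariance
along the left directions of column `col`. [folklore] -/
theorem qi_leftDir_of_after (hT : IsArchDistribution n K T)
    (hL : ∀ (u : ↥(upperUnitriangular (Fin n) (mixedSpace K))) (f : ↥(archTestFunctions n K)),
      T (archTestFunctions.leftTranslate (u : G∞) f) = archWhittakerChar n K u * T f)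
    (i col : Fin n) (hic : i < col) (k : Fin r)
    (hafter : ∀ (i' j' : Fin n) (h' : i' < j') (k' : Fin r), col < j' → QI T (leftDir θ i' j' h' k')) :
    QI T (leftDir θ i col hic k) := by
  intro h hh hW t
  set E : Mat := Matrix.single i col (θ k) with hEdef
  have hE : E ∈ strictUpper n R∞ := single_mem_strictUpper hic _
  have hEE : E * E = 0 := Matrix.single_mul_single_of_ne (c := θ k) i col i (ne_of_gt hic) (θ k)
  -- the index lists: the block of row `i` beyond `col`, then the rest of the columns `> col`
  set BI : Finset (DirIdx n r) := Finset.univ.filter fun ι => ι.1.1.1 = i ∧ col < ι.1.1.2 with hBI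
  set RI : Finset (DirIdx n r) := Finset.univ.filter fun ι => col < ι.1.1.2 ∧ ι.1.1.1 ≠ i with hRI
  set l : List (DirIdx n r ⊕ DirIdx n r) := (BI.toList ++ RI.toList).map Sum.inl with hl
  have hlnodup : l.Nodup := by
    refine List.Nodup.map Sum.inl_injective (List.Nodup.append (Finset.nodup_toList _) (Finset.nodup_toList _) ?_)
    intro ι h1 h2
    rw [Finset.mem_toList, hBI, Finset.mem_filter] at h1
    rw [Finset.mem_toList, hRI, Finset.mem_filter] at h2
    exact h2.2.2 h1.2.1
  set B : List (Direction E∞) := (BI.toList.map Sum.inl).map (dirLR θ) with hB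
  set M : List (Direction E∞) := (RI.toList.map Sum.inl).map (dirLR θ) with hM
  have hBM : B ++ M = l.map (dirLR θ) := by rw [hl, List.map_append, List.map_append]
  have hbio : Biorthogonal (B ++ M) := by rw [hBM]; exact biorthogonal_map_dirLR θ hlnodup
  have hmemB : ∀ d ∈ B, ∃ (b : Fin n) (hb : col < b) (k' : Fin r), d = leftDir θ i b (lt_trans hic hb) k' := by
    intro d hd
    rw [hB, List.map_map] at hd
    obtain ⟨⟨⟨⟨i', b⟩, hib⟩, k'⟩, hι, rfl⟩ := List.mem_map.1 hd
    rw [Finset.mem_toList, hBI, Finset.mem_filter] at hι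
    obtain ⟨_, hi', hb⟩ := hι
    simp only at hi' hb
    subst hi'
    exact ⟨b, hb, k', rfl⟩
  have hq : ∀ a ∈ l, QI T (dirLR θ a) := by
    intro a ha
    rw [hl] at ha
    obtain ⟨ι, hι, rfl⟩ := List.mem_map.1 ha
    obtain ⟨⟨⟨i', j'⟩, hij'⟩, k'⟩ := ι
    have hj' : col < j' := by
      rcases List.mem_append.1 hι with h1 | h2
      · rw [Finset.mem_toList, hBI, Finset.mem_filter] at h1; exact h1.2.2
      · rw [Finset.mem_toList, hRI, Finset.mem_filter] at h2; exact h2.2.1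
    exact hafter i' j' hij' k' hj'
  -- the sheared relation from the left quasi-invariance of `T`
  have hadmL := admissible_comp_leftParamMap (rootElement E hE (-t)) hh hW
  have hfun : h ∘ leftParamMap (rootElement E hE (-t)) = fun x => h (x - t • (leftDir θ i col hic k).v - leftShearVec E hE t x) := by
    funext x; rw [Function.comp_apply, leftParamMap_rootElement_neg]; rfl
  have hS : cellPull T (fun x => h (x - t • (leftDir θ i col hic k).v - leftShearVec E hE t x)) =
      Complex.exp (((dirLam θ i col k * t : ℝ) : ℂ) * Complex.I) * cellPull T h := by
    rw [← hfun, cellPull_eq T hadmL.1 hadmL.2, cellPull_eq T hh hW, ← archWhittakerChar_rootElement θ i col hic k t,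
      ← hL (rootElement E hE t) (cellPushFn h ⟨hh, hW⟩)]
    congr 1
    apply Subtype.ext
    funext x
    rw [archTestFunctions.leftTranslate_apply, coe_cellPushFn, coe_cellPushFn, ← Subgroup.coe_inv, rootElement_inv hE hEE,
      cellPush_mul_left]
  have hsheared : IsTestFn (fun x => h (x - t • (leftDir θ i col hic k).v - leftShearVec E hE t x)) ∧
      tsupport (fun x => h (x - t • (leftDir θ i col hic k).v - leftShearVec E hE t x)) ⊆ cellSource n R∞ := by
    rw [← hfun]; exact hadmL
  have htr := admissible_translate θ (Sum.inl ⟨⟨(i, col), hic⟩, k⟩) hh hW t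
  refine apply_translate_eq_of_shear (D := cellPull T) (W := cellSource n R∞) hbio ?_ ?_ ?_ ?_ hsheared htr hS
  · intro b hb
    obtain ⟨b', hb', k', rfl⟩ := hmemB b hb
    exact dirLam_eq_zero_of_lt_lt θ i col b' hic hb' k'
  · intro G hG hGW
    rw [hBM]
    exact cellPull_eq_cellPull_lineProjList θ T hT hq hG hGW
  · intro x
    refine leftShearVec_mem_span θ i col hic k t x _ fun b hb k' => Submodule.subset_span ⟨⟨leftDir θ i b (lt_trans hic hb) k', ?_⟩, rfl⟩
    rw [hB, List.map_map, List.mem_map]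
    refine ⟨⟨⟨(i, b), lt_trans hic hb⟩, k'⟩, ?_, rfl⟩
    rw [Finset.mem_toList, hBI, Finset.mem_filter]
    exact ⟨Finset.mem_univ _, rfl, hb⟩
  · intro b hb
    obtain ⟨b', hb', k', rfl⟩ := hmemB b hb
    exact isLineInvariantV_leftShearVec θ i col hic k t b' (lt_trans hic hb') k'

/-- **The left induction**: `cellPull T` is quasi-invariant along every left coordinate direction. [folklore] -/
theorem qi_leftDir (hT : IsArchDistribution n K T)
    (hL : ∀ (u : ↥(upperUnitriangular (Fin n) (mixedSpace K))) (f : ↥(archTestFunctions n K)),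
      T (archTestFunctions.leftTranslate (u : G∞) f) = archWhittakerChar n K u * T f)
    (i j : Fin n) (hij : i < j) (k : Fin r) : QI T (leftDir θ i j hij k) := by
  -- downward induction on the column: `P d` = the claim for all columns `j ≥ n - 1 - d`
  suffices key : ∀ (d : ℕ) (i j : Fin n) (hij : i < j) (k : Fin r), n - 1 - d ≤ (j : ℕ) → QI T (leftDir θ i j hij k) from
    key n i j hij k (by omega)
  intro d
  induction d with
  | zero =>
    intro i j hij k hj
    have hlast : ∀ m : Fin n, m ≤ j := fun m => Fin.le_iff_val_le_val.2 (by have := m.2; omega)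
    intro h hh hW t
    exact cellPull_translate_leftDir_last θ T hL i j hij hlast k hh hW t
  | succ d ih =>
    intro i j hij k hj
    by_cases hj' : n - 1 - d ≤ (j : ℕ)
    · exact ih i j hij k hj'
    · exact qi_leftDir_of_after θ T hT hL i j hij k fun i' j' h' k' hjj' =>
        ih i' j' h' k' (by have : (j : ℕ) < j' := hjj'; omega)

end LeftStep

/-! ### 8. The right action: shears of the rows and the right induction -/

section RightShear

variable {r : ℕ} (θ : Module.Basis (Fin r) ℝ (mixedSpace K)) (T : ↥(archTestFunctions n K) →ₗ[ℂ] ℂ)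

/-- **The linear part of `rightParamMap u`**: `(X₁, a, X₂) ↦ (X₁, a, X₂ u)`. [folklore] -/
def rightParamLin (u : ↥(upperUnitriangular (Fin n) R∞)) : E∞ →L[ℝ] E∞ :=
  LinearMap.toContinuousLinearMap
    { toFun := fun e => (e.1, e.2.1, ⟨(e.2.2 : Mat) * ((u : G∞) : Mat),
        strictUpper_mul_upper e.2.2.2 (upper_of_mem_upperUnitriangular u)⟩)
      map_add' := fun e e' => by
        refine Prod.ext rfl (Prod.ext rfl (Subtype.ext ?_))
        simp only [Prod.snd_add, Submodule.coe_add, Matrix.add_mul]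
      map_smul' := fun c e => by
        refine Prod.ext rfl (Prod.ext rfl (Subtype.ext ?_))
        simp only [Prod.smul_snd, Submodule.coe_smul, RingHom.id_apply, Matrix.smul_mul] }

/-- `rightParamMap u` is the affine map `rightParamLin u + (0, 0, u - 1)`. [folklore] -/
theorem rightParamMap_eq_lin_add (u : ↥(upperUnitriangular (Fin n) R∞)) (e : E∞) :
    rightParamMap u e = rightParamLin u e + (0, 0, ⟨((u : G∞) : Mat) - 1, sub_one_mem_strictUpper u.2⟩) := by
  refine Prod.ext ?_ (Prod.ext ?_ (Subtype.ext ?_))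
  · simp [rightParamLin]
  · simp [rightParamLin]
  · simp only [rightParamMap_snd_snd, rightParamLin, LinearMap.coe_toContinuousLinearMap', LinearMap.coe_mk,
      AddHom.coe_mk, Prod.snd_add, Submodule.coe_add]
    rw [Matrix.add_mul, Matrix.one_mul]
    abel

/-- **`rightParamMap u` is smooth.** [folklore] -/
theorem contDiff_rightParamMap (u : ↥(upperUnitriangular (Fin n) R∞)) : ContDiff ℝ ∞ (rightParamMap u) := by
  have h : rightParamMap u = fun e => rightParamLin u e + (0, 0, ⟨((u : G∞) : Mat) - 1, sub_one_mem_strictUpper u.2⟩) :=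
    funext (rightParamMap_eq_lin_add u)
  rw [h]
  exact (rightParamLin u).contDiff.add contDiff_const

/-- **`rightParamMap u` as a homeomorphism** (inverse `rightParamMap u⁻¹`). [folklore] -/
def rightParamHomeo (u : ↥(upperUnitriangular (Fin n) R∞)) : E∞ ≃ₜ E∞ where
  toFun := rightParamMap u
  invFun := rightParamMap u⁻¹
  left_inv e := by rw [← rightParamMap_mul, mul_inv_cancel, rightParamMap_one]
  right_inv e := by rw [← rightParamMap_mul, inv_mul_cancel, rightParamMap_one]
  continuous_toFun := (contDiff_rightParamMap u).continuous
  continuous_invFun := (contDiff_rightParamMap u⁻¹).continuous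

/-- **Admissibility is preserved by `rightParamMap u`.** [folklore] -/
theorem admissible_comp_rightParamMap (u : ↥(upperUnitriangular (Fin n) R∞)) {h : E∞ → ℂ} (hh : IsTestFn h)
    (hW : tsupport h ⊆ cellSource n R∞) :
    IsTestFn (h ∘ rightParamMap u) ∧ tsupport (h ∘ rightParamMap u) ⊆ cellSource n R∞ := by
  refine ⟨⟨hh.contDiff.comp (contDiff_rightParamMap u), hh.hasCompactSupport.comp_homeomorph (rightParamHomeo u)⟩, ?_⟩
  have hsub : tsupport (h ∘ rightParamMap u) ⊆ rightParamMap u ⁻¹' tsupport h := by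
    refine closure_minimal ?_ ((isClosed_tsupport h).preimage (contDiff_rightParamMap u).continuous)
    rw [Function.support_comp_eq_preimage]
    exact Set.preimage_mono subset_closure
  intro x hx
  have h1 : rightParamMap u x ∈ cellSource n R∞ := hW (hsub hx)
  exact h1

/-- **The right shear vector field** of `E`: `U_s(x) = (0, 0, s X₂ E)`. [folklore] -/
def rightShearVec (E : Mat) (hE : E ∈ strictUpper n R∞) (s : ℝ) (x : E∞) : E∞ :=
  (0, 0, ⟨s • ((x.2.2 : Mat) * E), (strictUpperReal n R∞).smul_mem s (strictUpper_mul x.2.2.2 hE)⟩)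

/-- The third component of the right shear field. [folklore] -/
@[simp] theorem rightShearVec_snd_snd (E : Mat) (hE : E ∈ strictUpper n R∞) (s : ℝ) (x : E∞) :
    ((rightShearVec E hE s x).2.2 : Mat) = s • ((x.2.2 : Mat) * E) := rfl

/-- **The right action of a root element in coordinates is a sheared translation**:
`rightParamMap (1 - tE) x = x - t (0, 0, E) - U_t(x)`. [folklore] -/
theorem rightParamMap_rootElement_neg (E : Mat) (hE : E ∈ strictUpper n R∞) (t : ℝ) (x : E∞) :
    rightParamMap (rootElement E hE (-t)) x = x - t • rightRootVector E hE - rightShearVec E hE t x := by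
  obtain ⟨X₁, a, ⟨X₂, hX₂⟩⟩ := x
  refine Prod.ext ?_ (Prod.ext ?_ (Subtype.ext ?_))
  · simp [rightRootVector, rightShearVec]
  · simp [rightRootVector, rightShearVec]
  · simp only [rightParamMap_snd_snd, coe_rootElement, rightRootVector, rightShearVec, Prod.snd_sub, Prod.smul_snd,
      Submodule.coe_sub, Submodule.coe_smul]
    rw [mul_add, Matrix.mul_one, Matrix.add_mul, Matrix.one_mul, mul_smul_comm, neg_smul, neg_smul]
    abel

omit [NumberField K] in
/-- **Column-`j` matrices above row `i` expand in the elementary matrices `single a j (θ k')`.** [folklore] -/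
theorem eq_sum_single_of_col (i j : Fin n) {Y : Mat} (hY : ∀ a b : Fin n, ¬(b = j ∧ a < i) → Y a b = 0) :
    Y = ∑ a : {a : Fin n // a < i}, ∑ k' : Fin r, θ.coord k' (Y a.1 j) • Matrix.single a.1 j (θ k') := by
  refine Matrix.ext fun a' b => ?_
  simp only [Matrix.sum_apply, Matrix.smul_apply]
  by_cases hab : b = j ∧ a' < i
  · obtain ⟨rfl, ha'⟩ := hab
    rw [Finset.sum_eq_single (⟨a', ha'⟩ : {a : Fin n // a < i}) (fun a _ ha => ?_) (fun h => absurd (Finset.mem_univ _) h)]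
    · simp only [Matrix.single_apply_same]
      conv_lhs => rw [← θ.sum_repr (Y a' b)]
      refine Finset.sum_congr rfl fun k' _ => ?_
      rw [Module.Basis.coord_apply]
    · refine Finset.sum_eq_zero fun k' _ => ?_
      rw [show Matrix.single a.1 b (θ k') a' b = 0 by
        simp only [Matrix.single, Matrix.of_apply, and_true]
        rw [if_neg (fun h : a.1 = a' => ha (Subtype.ext h))], smul_zero]
  · rw [hY a' b hab]
    symm
    refine Finset.sum_eq_zero fun a _ => Finset.sum_eq_zero fun k' _ => ?_
    rw [show Matrix.single a.1 j (θ k') a' b = 0 by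
      simp only [Matrix.single, Matrix.of_apply]
      rw [if_neg]
      rintro ⟨rfl, rfl⟩
      exact hab ⟨rfl, a.2⟩, smul_zero]

/-- **The right shear field lies in the span of the block directions** `(rightDir a j k')`, `a < i`. [folklore] -/
theorem rightShearVec_mem_span (i j : Fin n) (hij : i < j) (k : Fin r) (t : ℝ) (x : E∞)
    (S : Submodule ℝ E∞) (hS : ∀ (a : Fin n) (ha : a < i) (k' : Fin r), (rightDir θ a j (lt_trans ha hij) k').v ∈ S) :
    rightShearVec (Matrix.single i j (θ k)) (single_mem_strictUpper hij _) t x ∈ S := by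
  set Y : Mat := t • ((x.2.2 : Mat) * Matrix.single i j (θ k)) with hYdef
  have hY : ∀ a b : Fin n, ¬(b = j ∧ a < i) → Y a b = 0 := by
    intro a b hab
    simp only [hYdef, Matrix.smul_apply]
    by_cases hb : b = j
    · subst hb
      rw [Matrix.mul_single_apply_same, x.2.2.2 a i (not_lt.1 fun ha => hab ⟨rfl, ha⟩), zero_mul, smul_zero]
    · rw [Matrix.mul_single_apply_of_ne (c := θ k) i j a b hb, smul_zero]
  set ι₃ : ↥(strictUpperReal n R∞) →ₗ[ℝ] E∞ :=
    (LinearMap.inr ℝ ↥(strictUpperReal n R∞) ((Fin n → R∞) × ↥(strictUpperReal n R∞))).comp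
      (LinearMap.inr ℝ (Fin n → R∞) ↥(strictUpperReal n R∞)) with hι₃
  have hvec : rightShearVec (Matrix.single i j (θ k)) (single_mem_strictUpper hij _) t x =
      ∑ a : {a : Fin n // a < i}, ∑ k' : Fin r, θ.coord k' (Y a.1 j) • (rightDir θ a.1 j (lt_trans a.2 hij) k').v := by
    have hx2 : (x.2.2 : Mat) ∈ strictUpper n R∞ := x.2.2.2
    have h1 : rightShearVec (Matrix.single i j (θ k)) (single_mem_strictUpper hij _) t x =
        ι₃ ⟨Y, (strictUpperReal n R∞).smul_mem t (strictUpper_mul hx2 (single_mem_strictUpper hij _))⟩ := rfl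
    have h2 : ∀ (a : {a : Fin n // a < i}) (k' : Fin r), (rightDir θ a.1 j (lt_trans a.2 hij) k').v =
        ι₃ ⟨Matrix.single a.1 j (θ k'), single_mem_strictUpper (lt_trans a.2 hij) _⟩ := fun a k' => rfl
    simp_rw [h1, h2, ← map_smul, ← _root_.map_sum]
    congr 1
    apply Subtype.ext
    simp only [Submodule.coe_sum, Submodule.coe_smul]
    exact eq_sum_single_of_col θ i j hY
  rw [hvec]
  exact Submodule.sum_mem _ fun a _ => Submodule.sum_mem _ fun k' _ => Submodule.smul_mem _ _ (hS a.1 a.2 k')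

/-- **The right shear field is constant along the block lines** (it only depends on column `i` of `X₂`). [folklore] -/
theorem isLineInvariantV_rightShearVec (i j : Fin n) (hij : i < j) (k : Fin r) (t : ℝ) (a : Fin n) (haj : a < j)
    (k' : Fin r) :
    IsLineInvariantV (rightDir θ a j haj k') (rightShearVec (Matrix.single i j (θ k)) (single_mem_strictUpper hij _) t) := by
  intro x s
  refine Prod.ext rfl (Prod.ext rfl (Subtype.ext ?_))
  simp only [rightShearVec_snd_snd, Prod.snd_add, Prod.smul_snd, Prod.snd_sub, Submodule.coe_add, Submodule.coe_smul,
    Submodule.coe_sub, rightDir_v_snd_snd]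
  rw [Matrix.add_mul, Matrix.sub_mul, Matrix.smul_mul, Matrix.smul_mul,
    Matrix.single_mul_single_of_ne (c := θ k') a j i (ne_of_gt hij) (θ k), smul_zero, smul_zero, zero_add, sub_zero]

/-- Block directions `(a, j)` with `a < i < j` are untwisted. [folklore] -/
theorem dirLam_eq_zero_of_lt_lt' (a i j : Fin n) (hai : a < i) (hij : i < j) (k' : Fin r) : dirLam θ a j k' = 0 := by
  unfold dirLam
  rw [if_neg]
  have h1 : (a : ℕ) < i := hai
  have h2 : (i : ℕ) < j := hij
  omega

/-- **The right step**: quasi-invariance along all right directions of the rows `< i` implies quasi-invariance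
along the right directions of row `i`. [folklore] -/
theorem qi_rightDir_of_before (hT : IsArchDistribution n K T)
    (hR : ∀ (u : ↥(upperUnitriangular (Fin n) (mixedSpace K))) (f : ↥(archTestFunctions n K)),
      T (archTestFunctions.rightTranslate (u : G∞) f) = (archWhittakerChar n K u)⁻¹ * T f)
    (i j : Fin n) (hij : i < j) (k : Fin r)
    (hbefore : ∀ (a j' : Fin n) (h' : a < j') (k' : Fin r), a < i → QI T (rightDir θ a j' h' k')) :
    QI T (rightDir θ i j hij k) := by
  intro h hh hW t
  set E : Mat := Matrix.single i j (θ k) with hEdef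
  have hE : E ∈ strictUpper n R∞ := single_mem_strictUpper hij _
  -- index lists: the block of column `j` above row `i`, then the other right directions of rows `< i`
  set BI : Finset (DirIdx n r) := Finset.univ.filter fun ι => ι.1.1.2 = j ∧ ι.1.1.1 < i with hBI
  set RI : Finset (DirIdx n r) := Finset.univ.filter fun ι => ι.1.1.1 < i ∧ ι.1.1.2 ≠ j with hRI
  set l : List (DirIdx n r ⊕ DirIdx n r) := (BI.toList ++ RI.toList).map Sum.inr with hl
  have hlnodup : l.Nodup := by
    refine List.Nodup.map Sum.inr_injective (List.Nodup.append (Finset.nodup_toList _) (Finset.nodup_toList _) ?_)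
    intro ι h1 h2
    rw [Finset.mem_toList, hBI, Finset.mem_filter] at h1
    rw [Finset.mem_toList, hRI, Finset.mem_filter] at h2
    exact h2.2.2 h1.2.1
  set B : List (Direction E∞) := (BI.toList.map Sum.inr).map (dirLR θ) with hB
  set M : List (Direction E∞) := (RI.toList.map Sum.inr).map (dirLR θ) with hM
  have hBM : B ++ M = l.map (dirLR θ) := by rw [hl, List.map_append, List.map_append]
  have hbio : Biorthogonal (B ++ M) := by rw [hBM]; exact biorthogonal_map_dirLR θ hlnodup
  have hmemB : ∀ d ∈ B, ∃ (a : Fin n) (ha : a < i) (k' : Fin r), d = rightDir θ a j (lt_trans ha hij) k' := by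
    intro d hd
    rw [hB, List.map_map] at hd
    obtain ⟨⟨⟨⟨a, j'⟩, haj'⟩, k'⟩, hι, rfl⟩ := List.mem_map.1 hd
    rw [Finset.mem_toList, hBI, Finset.mem_filter] at hι
    obtain ⟨_, hj', ha⟩ := hι
    simp only at hj' ha
    subst hj'
    exact ⟨a, ha, k', rfl⟩
  have hq : ∀ a ∈ l, QI T (dirLR θ a) := by
    intro a ha
    rw [hl] at ha
    obtain ⟨ι, hι, rfl⟩ := List.mem_map.1 ha
    obtain ⟨⟨⟨a', j'⟩, haj'⟩, k'⟩ := ι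
    have ha' : a' < i := by
      rcases List.mem_append.1 hι with h1 | h2
      · rw [Finset.mem_toList, hBI, Finset.mem_filter] at h1; exact h1.2.2
      · rw [Finset.mem_toList, hRI, Finset.mem_filter] at h2; exact h2.2.1
    exact hbefore a' j' haj' k' ha'
  -- the sheared relation from the right quasi-invariance of `T` (with the root element at `-t`)
  have hadmR := admissible_comp_rightParamMap (rootElement E hE (-t)) hh hW
  have hfun : h ∘ rightParamMap (rootElement E hE (-t)) =
      fun x => h (x - t • (rightDir θ i j hij k).v - rightShearVec E hE t x) := by
    funext x; rw [Function.comp_apply, rightParamMap_rootElement_neg]; rfl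
  have hchar : Complex.exp (((dirLam θ i j k * t : ℝ) : ℂ) * Complex.I) =
      (archWhittakerChar n K (rootElement E hE (-t)))⁻¹ := by
    have h1 : archWhittakerChar n K (rootElement E hE (-t)) = Complex.exp (((dirLam θ i j k * -t : ℝ) : ℂ) * Complex.I) :=
      archWhittakerChar_rootElement θ i j hij k (-t)
    rw [h1, ← Complex.exp_neg]
    congr 1
    push_cast
    ring
  have hS : cellPull T (fun x => h (x - t • (rightDir θ i j hij k).v - rightShearVec E hE t x)) =
      Complex.exp (((dirLam θ i j k * t : ℝ) : ℂ) * Complex.I) * cellPull T h := by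
    rw [← hfun, cellPull_eq T hadmR.1 hadmR.2, cellPull_eq T hh hW, hchar, ← hR (rootElement E hE (-t)) (cellPushFn h ⟨hh, hW⟩)]
    congr 1
    apply Subtype.ext
    funext x
    rw [archTestFunctions.rightTranslate_apply, coe_cellPushFn, coe_cellPushFn, cellPush_mul_right]
  have hsheared : IsTestFn (fun x => h (x - t • (rightDir θ i j hij k).v - rightShearVec E hE t x)) ∧
      tsupport (fun x => h (x - t • (rightDir θ i j hij k).v - rightShearVec E hE t x)) ⊆ cellSource n R∞ := by
    rw [← hfun]; exact hadmR
  have htr := admissible_translate θ (Sum.inr ⟨⟨(i, j), hij⟩, k⟩) hh hW t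
  refine apply_translate_eq_of_shear (D := cellPull T) (W := cellSource n R∞) hbio ?_ ?_ ?_ ?_ hsheared htr hS
  · intro b hb
    obtain ⟨a, ha, k', rfl⟩ := hmemB b hb
    exact dirLam_eq_zero_of_lt_lt' θ a i j ha hij k'
  · intro G hG hGW
    rw [hBM]
    exact cellPull_eq_cellPull_lineProjList θ T hT hq hG hGW
  · intro x
    refine rightShearVec_mem_span θ i j hij k t x _ fun a ha k' => Submodule.subset_span ⟨⟨rightDir θ a j (lt_trans ha hij) k', ?_⟩, rfl⟩
    rw [hB, List.map_map, List.mem_map]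
    refine ⟨⟨⟨(a, j), lt_trans ha hij⟩, k'⟩, ?_, rfl⟩
    rw [Finset.mem_toList, hBI, Finset.mem_filter]
    exact ⟨Finset.mem_univ _, rfl, ha⟩
  · intro b hb
    obtain ⟨a, ha, k', rfl⟩ := hmemB b hb
    exact isLineInvariantV_rightShearVec θ i j hij k t a (lt_trans ha hij) k'

/-- **The right induction**: `cellPull T` is quasi-invariant along every right coordinate direction. [folklore] -/
theorem qi_rightDir (hT : IsArchDistribution n K T)
    (hR : ∀ (u : ↥(upperUnitriangular (Fin n) (mixedSpace K))) (f : ↥(archTestFunctions n K)),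
      T (archTestFunctions.rightTranslate (u : G∞) f) = (archWhittakerChar n K u)⁻¹ * T f)
    (i j : Fin n) (hij : i < j) (k : Fin r) : QI T (rightDir θ i j hij k) := by
  -- upward induction on the row
  suffices key : ∀ (m : ℕ) (i j : Fin n) (hij : i < j) (k : Fin r), (i : ℕ) ≤ m → QI T (rightDir θ i j hij k) from
    key i i j hij k le_rfl
  intro m
  induction m with
  | zero =>
    intro i j hij k hi
    have hfirst : ∀ m' : Fin n, i ≤ m' := fun m' => Fin.le_iff_val_le_val.2 (by omega)
    intro h hh hW t
    exact cellPull_translate_rightDir_first θ T hR i j hij hfirst k hh hW t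
  | succ m ih =>
    intro i j hij k hi
    by_cases hi' : (i : ℕ) ≤ m
    · exact ih i j hij k hi'
    · exact qi_rightDir_of_before θ T hT hR i j hij k fun a j' h' k' hai =>
        ih a j' h' k' (by have : (a : ℕ) < i := hai; omega)

/-- **`cellPull T` is quasi-invariant by pure translations along every coordinate direction of `𝔫 × 𝔫`.**
[folklore] -/
theorem qi_dirLR (hT : IsArchDistribution n K T)
    (hL : ∀ (u : ↥(upperUnitriangular (Fin n) (mixedSpace K))) (f : ↥(archTestFunctions n K)),
      T (archTestFunctions.leftTranslate (u : G∞) f) = archWhittakerChar n K u * T f)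
    (hR : ∀ (u : ↥(upperUnitriangular (Fin n) (mixedSpace K))) (f : ↥(archTestFunctions n K)),
      T (archTestFunctions.rightTranslate (u : G∞) f) = (archWhittakerChar n K u)⁻¹ * T f)
    (a : DirIdx n r ⊕ DirIdx n r) : QI T (dirLR θ a) := by
  rcases a with ⟨⟨⟨i, j⟩, hij⟩, k⟩ | ⟨⟨⟨i, j⟩, hij⟩, k⟩
  · exact qi_leftDir θ T hT hL i j hij k
  · exact qi_rightDir θ T hT hR i j hij k

end RightShear

/-! ### 9. The Gelfand–Kazhdan involution in coordinates -/

section Iota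

variable {r : ℕ} (θ : Module.Basis (Fin r) ℝ (mixedSpace K))

/-- **`X ↦ X♯` on `𝔫`** as a linear map. [folklore] -/
def weylSharpLin : ↥(strictUpperReal n R∞) →ₗ[ℝ] ↥(strictUpperReal n R∞) where
  toFun X := ⟨weylSharp (X : Mat), weylSharp_mem_strictUpper X.2⟩
  map_add' X Y := Subtype.ext (by simp only [Submodule.coe_add]; exact weylSharp_add _ _)
  map_smul' c X := Subtype.ext (by simp only [Submodule.coe_smul, RingHom.id_apply]; exact weylSharp_smul _ _)

/-- The matrix of `weylSharpLin X`. [folklore] -/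
@[simp] theorem coe_weylSharpLin (X : ↥(strictUpperReal n R∞)) :
    ((weylSharpLin X : ↥(strictUpperReal n R∞)) : Mat) = weylSharp (X : Mat) := rfl

/-- **The involution `ι̃(X₁, a, X₂) = (X₂♯, a, X₁♯)` of the parameter space** (the Gelfand–Kazhdan involution
in the coordinates of the big cell, `weylLong_transpose_bigCellMap_weylLong`), as a linear map. [folklore] -/
def iotaLin : E∞ →ₗ[ℝ] E∞ where
  toFun e := (weylSharpLin e.2.2, e.2.1, weylSharpLin e.1)
  map_add' e e' := by simp only [Prod.fst_add, Prod.snd_add, map_add, Prod.mk_add_mk]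
  map_smul' c e := by simp only [Prod.smul_fst, Prod.smul_snd, map_smul, RingHom.id_apply, Prod.smul_mk]

/-- **`ι̃` as a plain function** (all topological statements are made for this form). [folklore] -/
def iotaFun (e : E∞) : E∞ := (weylSharpLin e.2.2, e.2.1, weylSharpLin e.1)

/-- `⇑iotaLin = iotaFun`. [folklore] -/
theorem coe_iotaLin : ⇑(iotaLin (n := n) (K := K)) = iotaFun := rfl

/-- `ι̃` as a continuous linear map (finite dimension). [folklore] -/
def iotaE : E∞ →L[ℝ] E∞ := LinearMap.toContinuousLinearMap iotaLin

/-- The function of `iotaE` is `iotaFun`. [folklore] -/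
theorem coe_iotaE : ⇑(iotaE (n := n) (K := K)) = iotaFun := rfl

/-- Components of `ι̃ e`. [folklore] -/
@[simp] theorem iotaFun_fst (e : E∞) : (((iotaFun e : E∞)).1 : Mat) = weylSharp (e.2.2 : Mat) := rfl

/-- Components of `ι̃ e`. [folklore] -/
@[simp] theorem iotaFun_snd_fst (e : E∞) : ((iotaFun e : E∞)).2.1 = e.2.1 := rfl

/-- Components of `ι̃ e`. [folklore] -/
@[simp] theorem iotaFun_snd_snd (e : E∞) : (((iotaFun e : E∞)).2.2 : Mat) = weylSharp (e.1 : Mat) := rfl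

/-- `ι̃` is an involution. [folklore] -/
theorem iotaFun_iotaFun (e : E∞) : iotaFun (iotaFun e) = e := by
  refine Prod.ext (Subtype.ext ?_) (Prod.ext rfl (Subtype.ext ?_))
  · simp only [iotaFun_fst, iotaFun_snd_snd, weylSharp_weylSharp]
  · simp only [iotaFun_snd_snd, iotaFun_fst, weylSharp_weylSharp]

/-- **`ι̃` is smooth** (a linear map in finite dimension). [folklore] -/
theorem contDiff_iotaFun : ContDiff ℝ ∞ (iotaFun (n := n) (K := K)) := by
  have h : ContDiff ℝ ∞ ⇑(iotaE (n := n) (K := K)) := ContinuousLinearMap.contDiff _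
  rwa [coe_iotaE] at h

/-- `ι̃` preserves `cellSource` (the torus coordinate is unchanged). [folklore] -/
theorem iotaFun_mem_cellSource {e : E∞} (he : e ∈ cellSource n R∞) : iotaFun e ∈ cellSource n R∞ := he

/-- **`Ψ(ι̃ e) = Ψ(e)♯`.** [folklore] -/
theorem cellChart_iotaFun (e : E∞) : cellChart (iotaFun e) = weylSharp (cellChart e) := by
  rw [cellChart, cellChart, iotaFun_fst, iotaFun_snd_fst, iotaFun_snd_snd]
  conv_rhs => rw [weylSharp]
  exact (weylLong_transpose_bigCellMap_weylLong _ _ _).symm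

omit [NumberField K] in
/-- **The matrix of `ι(g)` is `g♯`.** [folklore] -/
theorem coe_gkInvolution_eq_weylSharp (g : G∞) : ((gkInvolution g : G∞) : Mat) = weylSharp (g : Mat) :=
  Matrix.ext fun i j => by rw [coe_gkInvolution_apply, weylSharp_apply]

/-- The big cell is `♯`-stable, with `Ψ⁻¹(g♯) = ι̃ (Ψ⁻¹ g)`. [folklore] -/
theorem weylSharp_mem_bruhatBigCell {g : Mat} (hg : g ∈ bruhatBigCell n R∞) :
    weylSharp g ∈ bruhatBigCell n R∞ ∧ (cellChartHomeo n R∞).symm (weylSharp g) = iotaFun ((cellChartHomeo n R∞).symm g) := by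
  set e := (cellChartHomeo n R∞).symm g with he
  have hes : e ∈ cellSource n R∞ := (cellChartHomeo n R∞).map_target hg
  have hge : g = cellChart e := by rw [he, ← cellChartHomeo_apply, (cellChartHomeo n R∞).right_inv hg]
  have h1 : weylSharp g = cellChart (iotaFun e) := by rw [cellChart_iotaFun, hge]
  refine ⟨?_, ?_⟩
  · rw [h1]; exact (cellChartHomeo n R∞).map_source (iotaFun_mem_cellSource hes)
  · rw [h1, ← cellChartHomeo_apply, (cellChartHomeo n R∞).left_inv (iotaFun_mem_cellSource hes)]

/-- **`(cellPush h) ∘ ι = cellPush (h ∘ ι̃)`.** [folklore] -/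
theorem cellPush_gkInvolution (h : E∞ → ℂ) (x : G∞) : cellPush h (gkInvolution x) = cellPush (h ∘ iotaFun) x := by
  have hcoe : ((gkInvolution x : G∞) : Mat) = weylSharp (x : Mat) := coe_gkInvolution_eq_weylSharp x
  unfold cellPush
  rw [hcoe]
  by_cases hx : (x : Mat) ∈ bruhatBigCell n R∞
  · obtain ⟨hmem, hsymm⟩ := weylSharp_mem_bruhatBigCell hx
    rw [if_pos hmem, if_pos hx, Function.comp_apply, hsymm]
  · have hx' : weylSharp (x : Mat) ∉ bruhatBigCell n R∞ := fun hmem => by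
      apply hx
      have h1 := (weylSharp_mem_bruhatBigCell hmem).1
      rwa [weylSharp_weylSharp] at h1
    rw [if_neg hx', if_neg hx]

/-- **Admissibility is preserved by `ι̃`.** [folklore] -/
theorem admissible_comp_iotaFun {h : E∞ → ℂ} (hh : IsTestFn h) (hW : tsupport h ⊆ cellSource n R∞) :
    IsTestFn (h ∘ iotaFun) ∧ tsupport (h ∘ iotaFun) ⊆ cellSource n R∞ := by
  have hsub : tsupport (h ∘ iotaFun) ⊆ iotaFun ⁻¹' tsupport h := by
    refine closure_minimal ?_ ((isClosed_tsupport h).preimage (contDiff_iotaFun (n := n) (K := K)).continuous)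
    rw [Function.support_comp_eq_preimage]
    exact Set.preimage_mono subset_closure
  have hsub' : tsupport (h ∘ iotaFun) ⊆ iotaFun '' tsupport h := fun x hx =>
    ⟨iotaFun x, hsub hx, iotaFun_iotaFun x⟩
  refine ⟨⟨hh.contDiff.comp contDiff_iotaFun,
    IsCompact.of_isClosed_subset (hh.hasCompactSupport.isCompact.image (contDiff_iotaFun (n := n) (K := K)).continuous)
      (isClosed_tsupport _) hsub'⟩, ?_⟩
  intro x hx
  have h1 : iotaFun x ∈ cellSource n R∞ := hW (hsub hx)
  exact h1

omit [NumberField K] in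
/-- `0♯ = 0`. [folklore] -/
@[simp] theorem weylSharp_zero : weylSharp (0 : Mat) = 0 := by
  refine Matrix.ext fun a b => ?_
  rw [weylSharp_apply, Matrix.zero_apply, Matrix.zero_apply]

omit [NumberField K] in
/-- `(single i j c)♯ = single (rev j) (rev i) c`. [folklore] -/
theorem weylSharp_single (i j : Fin n) (c : R∞) : weylSharp (Matrix.single i j c) = Matrix.single j.rev i.rev c := by
  refine Matrix.ext fun a b => ?_
  rw [weylSharp_apply]
  simp only [Matrix.single, Matrix.of_apply]
  by_cases h : i = b.rev ∧ j = a.rev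
  · rw [if_pos h, if_pos ⟨by rw [h.2, Fin.rev_rev], by rw [h.1, Fin.rev_rev]⟩]
  · rw [if_neg h, if_neg]
    rintro ⟨rfl, rfl⟩
    exact h ⟨by rw [Fin.rev_rev], by rw [Fin.rev_rev]⟩

/-- `dirLam` is compatible with the reversal `(i, j) ↦ (rev j, rev i)`. [folklore] -/
theorem dirLam_rev (i j : Fin n) (hij : i < j) (k : Fin r) : dirLam θ j.rev i.rev k = dirLam θ i j k := by
  unfold dirLam
  have h1 : ((j.rev : Fin n) : ℕ) + 1 = (i.rev : Fin n) ↔ (i : ℕ) + 1 = j := by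
    rw [Fin.val_rev, Fin.val_rev]; have := i.2; have := j.2; have : (i : ℕ) < j := hij; omega
  by_cases h : (i : ℕ) + 1 = j
  · rw [if_pos h, if_pos (h1.2 h)]
  · rw [if_neg h, if_neg (fun h' => h (h1.1 h'))]

/-- **`ι̃` maps left directions to right directions** (compatibly with coordinates and characters). [folklore] -/
theorem related_leftDir (i j : Fin n) (hij : i < j) (k : Fin r) :
    Direction.Related iotaE (leftDir θ i j hij k) (rightDir θ j.rev i.rev (Fin.rev_lt_rev.2 hij) k) where
  map_v := by
    rw [coe_iotaE]
    refine Prod.ext (Subtype.ext ?_) (Prod.ext rfl (Subtype.ext ?_))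
    · simp only [iotaFun_fst, leftDir_v_snd_snd, rightDir_v_fst, weylSharp_zero]
    · simp only [iotaFun_snd_snd, leftDir_v_fst, rightDir_v_snd_snd, weylSharp_single]
  comp_φ := by
    refine ContinuousLinearMap.ext fun e => ?_
    rw [ContinuousLinearMap.comp_apply, coe_iotaE, rightDir_φ_apply, leftDir_φ_apply, iotaFun_snd_snd, weylSharp_apply,
      Fin.rev_rev, Fin.rev_rev]
  lam_eq := by rw [leftDir_lam, rightDir_lam, dirLam_rev θ i j hij k]

/-- **`ι̃` maps right directions to left directions.** [folklore] -/
theorem related_rightDir (i j : Fin n) (hij : i < j) (k : Fin r) :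
    Direction.Related iotaE (rightDir θ i j hij k) (leftDir θ j.rev i.rev (Fin.rev_lt_rev.2 hij) k) where
  map_v := by
    rw [coe_iotaE]
    refine Prod.ext (Subtype.ext ?_) (Prod.ext rfl (Subtype.ext ?_))
    · simp only [iotaFun_fst, rightDir_v_snd_snd, leftDir_v_fst, weylSharp_single]
    · simp only [iotaFun_snd_snd, rightDir_v_fst, leftDir_v_snd_snd, weylSharp_zero]
  comp_φ := by
    refine ContinuousLinearMap.ext fun e => ?_
    rw [ContinuousLinearMap.comp_apply, coe_iotaE, leftDir_φ_apply, rightDir_φ_apply, iotaFun_fst, weylSharp_apply,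
      Fin.rev_rev, Fin.rev_rev]
  lam_eq := by rw [leftDir_lam, rightDir_lam, dirLam_rev θ i j hij k]

/-- **The index swap of `ι̃`**: `(i, j, k)_L ↦ (rev j, rev i, k)_R` and vice versa. [folklore] -/
def swapIdx : DirIdx n r ⊕ DirIdx n r → DirIdx n r ⊕ DirIdx n r
  | Sum.inl ι => Sum.inr ⟨⟨(ι.1.1.2.rev, ι.1.1.1.rev), Fin.rev_lt_rev.2 ι.1.2⟩, ι.2⟩
  | Sum.inr ι => Sum.inl ⟨⟨(ι.1.1.2.rev, ι.1.1.1.rev), Fin.rev_lt_rev.2 ι.1.2⟩, ι.2⟩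

omit [NumberField K] in
/-- `swapIdx` is an involution. [folklore] -/
theorem swapIdx_swapIdx (a : DirIdx n r ⊕ DirIdx n r) : swapIdx (swapIdx a) = a := by
  rcases a with ⟨⟨⟨i, j⟩, hij⟩, k⟩ | ⟨⟨⟨i, j⟩, hij⟩, k⟩ <;> simp [swapIdx, Fin.rev_rev]

/-- **`ι̃` relates `dirLR a` to `dirLR (swapIdx a)`.** [folklore] -/
theorem related_dirLR_swapIdx (a : DirIdx n r ⊕ DirIdx n r) : Direction.Related iotaE (dirLR θ a) (dirLR θ (swapIdx a)) := by
  rcases a with ⟨⟨⟨i, j⟩, hij⟩, k⟩ | ⟨⟨⟨i, j⟩, hij⟩, k⟩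
  · exact related_leftDir θ i j hij k
  · exact related_rightDir θ i j hij k

omit [NumberField K] in
/-- **Strictly upper matrices expand in the elementary matrices `single i j (θ k)`, `i < j`.** [folklore] -/
theorem eq_sum_single_of_strictUpper {Y : Mat} (hY : Y ∈ strictUpper n R∞) :
    Y = ∑ p : {p : Fin n × Fin n // p.1 < p.2}, ∑ k' : Fin r, θ.coord k' (Y p.1.1 p.1.2) • Matrix.single p.1.1 p.1.2 (θ k') := by
  refine Matrix.ext fun a b => ?_
  simp only [Matrix.sum_apply, Matrix.smul_apply]
  by_cases hab : a < b
  · rw [Finset.sum_eq_single (⟨(a, b), hab⟩ : {p : Fin n × Fin n // p.1 < p.2}) (fun p _ hp => ?_)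
      (fun h => absurd (Finset.mem_univ _) h)]
    · simp only [Matrix.single_apply_same]
      conv_lhs => rw [← θ.sum_repr (Y a b)]
      refine Finset.sum_congr rfl fun k' _ => ?_
      rw [Module.Basis.coord_apply]
    · refine Finset.sum_eq_zero fun k' _ => ?_
      rw [show Matrix.single p.1.1 p.1.2 (θ k') a b = 0 by
        simp only [Matrix.single, Matrix.of_apply]
        rw [if_neg]
        rintro ⟨h1, h2⟩
        exact hp (Subtype.ext (Prod.ext h1 h2)), smul_zero]
  · rw [hY a b (not_lt.1 hab)]
    symm
    refine Finset.sum_eq_zero fun p _ => Finset.sum_eq_zero fun k' _ => ?_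
    rw [show Matrix.single p.1.1 p.1.2 (θ k') a b = 0 by
      simp only [Matrix.single, Matrix.of_apply]
      rw [if_neg]
      rintro ⟨rfl, rfl⟩
      exact hab p.2, smul_zero]

/-- **Vectors with zero torus component lie in the span of the coordinate directions.** [folklore] -/
theorem mem_of_torus_zero (S : Submodule ℝ E∞) (hS : ∀ a : DirIdx n r ⊕ DirIdx n r, (dirLR θ a).v ∈ S) (w : E∞)
    (hw : w.2.1 = 0) : w ∈ S := by
  obtain ⟨⟨Y₁, hY₁⟩, a, ⟨Y₂, hY₂⟩⟩ := w
  simp only at hw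
  subst hw
  -- the two embeddings of `𝔫`
  set ι₁ : ↥(strictUpperReal n R∞) →ₗ[ℝ] E∞ := LinearMap.inl ℝ _ _ with hι₁
  set ι₃ : ↥(strictUpperReal n R∞) →ₗ[ℝ] E∞ :=
    (LinearMap.inr ℝ ↥(strictUpperReal n R∞) ((Fin n → R∞) × ↥(strictUpperReal n R∞))).comp
      (LinearMap.inr ℝ (Fin n → R∞) ↥(strictUpperReal n R∞)) with hι₃
  have hsplit : ((⟨Y₁, hY₁⟩, (0 : Fin n → R∞), ⟨Y₂, hY₂⟩) : E∞) = ι₁ ⟨Y₁, hY₁⟩ + ι₃ ⟨Y₂, hY₂⟩ := by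
    refine Prod.ext (Subtype.ext ?_) (Prod.ext ?_ (Subtype.ext ?_)) <;> simp [hι₁, hι₃]
  rw [hsplit]
  refine S.add_mem ?_ ?_
  · have h1 : (⟨Y₁, hY₁⟩ : ↥(strictUpperReal n R∞)) = ∑ p : {p : Fin n × Fin n // p.1 < p.2}, ∑ k' : Fin r,
        θ.coord k' (Y₁ p.1.1 p.1.2) • ⟨Matrix.single p.1.1 p.1.2 (θ k'), single_mem_strictUpper p.2 _⟩ := by
      apply Subtype.ext
      simp only [Submodule.coe_sum, Submodule.coe_smul]
      exact eq_sum_single_of_strictUpper θ hY₁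
    rw [h1, _root_.map_sum]
    refine S.sum_mem fun p _ => ?_
    rw [_root_.map_sum]
    refine S.sum_mem fun k' _ => ?_
    rw [map_smul]
    exact S.smul_mem _ (hS (Sum.inl ⟨p, k'⟩))
  · have h1 : (⟨Y₂, hY₂⟩ : ↥(strictUpperReal n R∞)) = ∑ p : {p : Fin n × Fin n // p.1 < p.2}, ∑ k' : Fin r,
        θ.coord k' (Y₂ p.1.1 p.1.2) • ⟨Matrix.single p.1.1 p.1.2 (θ k'), single_mem_strictUpper p.2 _⟩ := by
      apply Subtype.ext
      simp only [Submodule.coe_sum, Submodule.coe_smul]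
      exact eq_sum_single_of_strictUpper θ hY₂
    rw [h1, _root_.map_sum]
    refine S.sum_mem fun p _ => ?_
    rw [_root_.map_sum]
    refine S.sum_mem fun k' _ => ?_
    rw [map_smul]
    exact S.smul_mem _ (hS (Sum.inr ⟨p, k'⟩))

/-- **Torus-free vectors lie in the span of the directions of any exhaustive index list.** [folklore] -/
theorem mem_span_dirLR_of_torus_zero {l : List (DirIdx n r ⊕ DirIdx n r)} (hl : ∀ a, a ∈ l) (w : E∞) (hw : w.2.1 = 0) :
    w ∈ Submodule.span ℝ (Set.range fun d : {d // d ∈ l.map (dirLR θ)} => d.1.v) := by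
  refine mem_of_torus_zero θ _ (fun a => Submodule.subset_span ?_) w hw
  exact ⟨⟨dirLR θ a, List.mem_map.2 ⟨a, hl a, rfl⟩⟩, rfl⟩

end Iota

/-! ### 10. The symmetry of the transported functional and the main theorem -/

section Main

variable {r : ℕ} (θ : Module.Basis (Fin r) ℝ (mixedSpace K)) (T : ↥(archTestFunctions n K) →ₗ[ℂ] ℂ)

include θ in
/-- **`cellPull T (h ∘ ι̃) = cellPull T h`** for admissible `h`, when `T` is a bi-`ψ_∞`-quasi-invariant
distribution (the argument `θ` is any real basis of `K_∞`, used for the coordinates). [folklore] -/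
theorem cellPull_comp_iotaFun (hT : IsArchDistribution n K T)
    (hL : ∀ (u : ↥(upperUnitriangular (Fin n) (mixedSpace K))) (f : ↥(archTestFunctions n K)),
      T (archTestFunctions.leftTranslate (u : G∞) f) = archWhittakerChar n K u * T f)
    (hR : ∀ (u : ↥(upperUnitriangular (Fin n) (mixedSpace K))) (f : ↥(archTestFunctions n K)),
      T (archTestFunctions.rightTranslate (u : G∞) f) = (archWhittakerChar n K u)⁻¹ * T f)
    {h : E∞ → ℂ} (hh : IsTestFn h) (hW : tsupport h ⊆ cellSource n R∞) :
    cellPull T (h ∘ iotaFun) = cellPull T h := by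
  have hall : ∀ a : DirIdx n r ⊕ DirIdx n r, QI T (dirLR θ a) := qi_dirLR θ T hT hL hR
  -- the master list of all coordinate directions and its swapped version
  set lall : List (DirIdx n r ⊕ DirIdx n r) := (Finset.univ : Finset (DirIdx n r ⊕ DirIdx n r)).toList with hlall
  have hnodup : lall.Nodup := Finset.nodup_toList _
  have hswinj : Function.Injective (swapIdx (n := n) (r := r)) := fun a b hab => by
    rw [← swapIdx_swapIdx a, hab, swapIdx_swapIdx]
  have hnodup' : (lall.map swapIdx).Nodup := hnodup.map hswinj
  set L : List (Direction E∞) := lall.map (dirLR θ) with hL'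
  set L' : List (Direction E∞) := (lall.map swapIdx).map (dirLR θ) with hL''
  have hbio : Biorthogonal L := biorthogonal_map_dirLR θ hnodup
  have hbio' : Biorthogonal L' := biorthogonal_map_dirLR θ hnodup'
  have hperm : L'.Perm L := by
    refine List.Perm.map _ ((List.perm_ext_iff_of_nodup hnodup' hnodup).2 fun a => ?_)
    simp only [List.mem_map, hlall, Finset.mem_toList, Finset.mem_univ, true_and, iff_true]
    exact ⟨swapIdx a, swapIdx_swapIdx a⟩
  have hrel : List.Forall₂ (Direction.Related iotaE) L L' := by
    rw [hL', hL'', List.map_map, List.forall₂_map_left_iff, List.forall₂_map_right_iff, List.forall₂_same]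
    intro a _
    exact related_dirLR_swapIdx θ a
  -- the structure theorem for both lists
  have hadm' := admissible_comp_iotaFun hh hW
  have h1 : cellPull T (h ∘ iotaFun) = cellPull T (lineProjList L (h ∘ iotaFun)) :=
    cellPull_eq_cellPull_lineProjList θ T hT (fun a _ => hall a) hadm'.1 hadm'.2
  have h2 : cellPull T h = cellPull T (lineProjList L' h) :=
    cellPull_eq_cellPull_lineProjList θ T hT (fun a _ => hall a) hh hW
  rw [h1, h2, lineProjList_eq_mul_lineAvgList L hbio, lineProjList_eq_mul_lineAvgList L' hbio', lineWeightList_perm hperm.symm]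
  congr 1
  funext x
  congr 1
  -- `A_L (h ∘ ι̃) (x) = A_{L'} h (ι̃ x) = A_{L'} h (x)`
  have h3 : lineAvgList L (h ∘ iotaFun) = lineAvgList L' h ∘ iotaE := by
    rw [← coe_iotaE]; exact lineAvgList_comp_linear hrel h
  rw [h3, Function.comp_apply, coe_iotaE, show iotaFun x = x + (iotaFun x - x) by abel]
  refine lineAvgList_add_eq_of_mem_span L' hbio' h ?_ x
  have hl' : ∀ a, a ∈ lall.map swapIdx := fun a =>
    List.mem_map.2 ⟨swapIdx a, by rw [hlall, Finset.mem_toList]; exact Finset.mem_univ _, swapIdx_swapIdx a⟩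
  have hw : (iotaFun x - x).2.1 = 0 := by simp only [Prod.snd_sub, Prod.fst_sub, iotaFun_snd_fst, sub_self]
  exact mem_span_dirLR_of_torus_zero θ hl' _ hw

/-- **Invertible chart values come from `cellSource`**: if `Ψ(e)` is invertible then the torus coordinate of `e`
is a unit. [folklore] -/
theorem mem_cellSource_of_isUnit_cellChart {e : E∞} (hu : IsUnit (cellChart e)) : e ∈ cellSource n R∞ := by
  obtain ⟨⟨X₁, hX₁⟩, a, ⟨X₂, hX₂⟩⟩ := e
  have hX₁' : X₁ ∈ strictUpper n R∞ := hX₁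
  have hX₂' : X₂ ∈ strictUpper n R∞ := hX₂
  have h1 : cellChart ((⟨X₁, hX₁⟩, a, ⟨X₂, hX₂⟩) : E∞) =
      ((unitri X₁ hX₁' * weylLong n R∞ : G∞) : Mat) * (diagonal a * ((unitri X₂ hX₂' : G∞) : Mat)) := by
    rw [cellChart_apply]
    simp only [Units.val_mul, coe_unitri, Matrix.mul_assoc]
  rw [h1, Units.isUnit_units_mul, Units.isUnit_mul_units, Matrix.isUnit_diagonal] at hu
  exact Pi.isUnit_iff.1 hu

/-- **The coordinate function of a test function supported in the big cell.** [folklore] -/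
def cellCoordFn (f : G∞ → ℂ) (e : E∞) : ℂ := archExtZero f (cellChart e)

/-- For `f` supported in the big cell, `cellCoordFn f` is admissible and pushes forward to `f`. [folklore] -/
theorem cellCoordFn_admissible (f : ↥(archTestFunctions n K))
    (hf : tsupport (f : G∞ → ℂ) ⊆ {g : G∞ | (g : Mat) ∈ bruhatBigCell n R∞}) :
    (IsTestFn (cellCoordFn (f : G∞ → ℂ)) ∧ tsupport (cellCoordFn (f : G∞ → ℂ)) ⊆ cellSource n R∞) ∧
      cellPush (cellCoordFn (f : G∞ → ℂ)) = (f : G∞ → ℂ) := by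
  have hfT : IsArchTestFunction n K (f : G∞ → ℂ) := f.2
  -- the compact set `Ψ⁻¹(val(tsupport f))`
  set Kf : Set Mat := ((↑) : G∞ → Mat) '' tsupport (f : G∞ → ℂ) with hKf
  have hKfc : IsCompact Kf := hfT.hasCompactSupport.isCompact.image Units.continuous_val
  have hKfsub : Kf ⊆ bruhatBigCell n R∞ := by rintro _ ⟨g, hg, rfl⟩; exact hf hg
  set S : Set E∞ := (cellChartHomeo n R∞).symm '' Kf with hS
  have hSc : IsCompact S := hKfc.image_of_continuousOn ((cellChartHomeo n R∞).continuousOn_symm.mono hKfsub)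
  have hSsub : S ⊆ cellSource n R∞ := by
    rintro _ ⟨m, hm, rfl⟩; exact (cellChartHomeo n R∞).map_target (hKfsub hm)
  have hsupp : Function.support (cellCoordFn (f : G∞ → ℂ)) ⊆ S := by
    intro e he
    rw [Function.mem_support, cellCoordFn, archExtZero] at he
    by_cases hunit : IsUnit (cellChart e)
    · rw [dif_pos hunit] at he
      have hes : e ∈ cellSource n R∞ := mem_cellSource_of_isUnit_cellChart hunit
      refine ⟨cellChart e, ⟨hunit.unit, subset_tsupport _ he, hunit.unit_spec⟩, ?_⟩
      rw [← cellChartHomeo_apply, (cellChartHomeo n R∞).left_inv hes]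
    · rw [dif_neg hunit] at he; exact absurd rfl he
  have htsupp : tsupport (cellCoordFn (f : G∞ → ℂ)) ⊆ S := closure_minimal hsupp hSc.isClosed
  refine ⟨⟨⟨hfT.contDiff_archExtZero.comp contDiff_cellChart, IsCompact.of_isClosed_subset hSc (isClosed_tsupport _) htsupp⟩,
    htsupp.trans hSsub⟩, ?_⟩
  funext g
  by_cases hg : (g : Mat) ∈ bruhatBigCell n R∞
  · rw [cellPush_apply_of_mem hg, cellCoordFn, cellChart_symm_apply hg, archExtZero_coe]
  · rw [cellPush_apply_of_not_mem hg]
    exact (image_eq_zero_of_notMem_tsupport fun h' => hg (hf h')).symm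

/-- **The easy half of the archimedean Gelfand–Kazhdan symmetry**: a bi-`ψ_∞`-quasi-invariant distribution `T`
on `GL_n(K_∞)` is `ι`-symmetric on the test functions supported in the big Bruhat cell `N w⁰ A N`
(Shalika 1974, §2, the open cell; Gelfand–Kazhdan 1975, §§3–4). [cite: Shalika1974, §2] -/
theorem archBiWhittaker_gkInvolution_stable_of_tsupport_subset_bigCell (hT : IsArchDistribution n K T)
    (hL : ∀ (u : ↥(upperUnitriangular (Fin n) (mixedSpace K))) (f : ↥(archTestFunctions n K)),
      T (archTestFunctions.leftTranslate (u : G∞) f) = archWhittakerChar n K u * T f)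
    (hR : ∀ (u : ↥(upperUnitriangular (Fin n) (mixedSpace K))) (f : ↥(archTestFunctions n K)),
      T (archTestFunctions.rightTranslate (u : G∞) f) = (archWhittakerChar n K u)⁻¹ * T f)
    (f : ↥(archTestFunctions n K))
    (hf : tsupport (f : G∞ → ℂ) ⊆ {g : G∞ | (g : Mat) ∈ bruhatBigCell n R∞}) :
    T (archTestFunctions.compGKInvolution f) = T f := by
  obtain ⟨hadm, hpush⟩ := cellCoordFn_admissible f hf
  set h : E∞ → ℂ := cellCoordFn (f : G∞ → ℂ) with hh
  have hf' : f = cellPushFn h hadm := Subtype.ext hpush.symm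
  have hadmι := admissible_comp_iotaFun hadm.1 hadm.2
  have hcomp : archTestFunctions.compGKInvolution (cellPushFn h hadm) = cellPushFn (h ∘ iotaFun) hadmι := by
    apply Subtype.ext
    funext x
    rw [archTestFunctions.compGKInvolution_apply, coe_cellPushFn, coe_cellPushFn, cellPush_gkInvolution]
  rw [hf', hcomp, ← cellPull_eq T hadmι.1 hadmι.2, ← cellPull_eq T hadm.1 hadm.2]
  exact cellPull_comp_iotaFun (Module.finBasis ℝ (mixedSpace K)) T hT hL hR hadm.1 hadm.2

end Main

end Literature.NumberTheory.Automorphic
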